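import Summits.RiemannHypothesis.RiemannHypothesis.Theses.SpectralTrace
import Literature.NumberTheory.LFunctions.WeilArchimedeanPositivityProofs
import Literature.NumberTheory.LFunctions.WeilArchimedeanMoments
import Literature.NumberTheory.LFunctions.WeilSmallSupportPositivity
import Literature.NumberTheory.LFunctions.WeilGroundState
import Literature.NumberTheory.LFunctions.WeilExplicitFormulaProofs
import Literature.NumberTheory.LFunctions.WeilZeroSum
import Literature.NumberTheory.LFunctions.WeilMellinInversion
import Literature.NumberTheory.LFunctions.WeilMellinBounds
import Literature.Analysis.SpecialFunctions.DigammaGauss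
import Literature.Analysis.SpecialFunctions.DigammaVerticalSeries
import Literature.NumberTheory.LFunctions.WeilExplicitProofs
import Literature.NumberTheory.LFunctions.FordZetaZeroRecipSqSum
import Literature.NumberTheory.LFunctions.RiemannHypothesisUpTo101
import Literature.NumberTheory.LFunctions.LagariasXiPositivityTable
import Literature.NumberTheory.LFunctions.Brent1979Reduction
import Literature.NumberTheory.LFunctions.SimpleZeros
import Literature.NumberTheory.LFunctions.ZetaZerosProofs

set_option linter.dupNamespace false

/-!
# Disproof work file for the crux `WindowTraceArch` (stmt-RiemannHypothesis-11195)

Standing adversary file (refuter, cdisprove seat). Prose lives only in docstrings.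

## Findings (indexed; details in the docstrings below)

* §0 `WindowTrace A` — the crux body with a free window half-width; `WindowTraceArch ↔
  WindowTrace (log 2)` by `Iff.rfl`.
* §1 LOAD-BEARING HYPOTHESES.
  - `windowTraceArch_false_without_isWeilTest` : dropping `IsWeilTest g` makes the statement
    FALSE (witness: the null modification `g = 𝟙_{0}`; `weilFunctional` reads the point value
    `g 0`, `weilMellin` only the a.e.-class). Any proof must use (at least) continuity of `g`.
  - `windowTraceArchWithoutWindow_iff_spectralThesis` : dropping the support hypothesis IS the
    target `X = SpectralThesis` (RH-equivalent in the tree); not refutable short of `¬ RH`.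
* §2 SMALL MODELS / NATURAL STRENGTHENINGS REFUTED.
  - `infinite_of_windowTrace` : for EVERY window `A > 0`, every witness family is infinite
    (Bombieri's coercivity `weilQuadratic_coercive` vs. `|ĝ(½+iγ)|² ≤ ‖g‖₁² ≤ 2a‖g‖₂²` on thin
    `L²`-normalised tests); `not_windowTrace_finite` : no finite spectrum at any `A > 0`;
  - `windowTrace_of_nonpos` : … and `0 < A` is sharp (the EMPTY family witnesses `A ≤ 0`).
  - §2b `not_bounded_localCount_of_windowTrace` : NO uniform bound `D` on the number of
    spectral points per unit cell `[k, k+1)` (L¹-Sobolev on cells + Plancherel: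
    `Σ_i |ĝ(γ_i)|² ≤ D ∫(2|ĝ|² + |ĝ'|²) ≤ 6πD ‖g‖₂²` vs coercivity `Q ≥ (19D+1)‖g‖₂²`);
    `exists_crowded_cell_of_windowTrace` (some cell holds > D points, every D);
    `not_separated_of_windowTrace` (no δ-separated = uniformly discrete witness: no Delone
    set, no uniformly discrete Fourier quasicrystal / model set); `not_windowTrace_lattice`
    (no `a + bℤ`, `b ≠ 0`). The local density of any witness is UNBOUNDED — the log-growth
    is forced by the window identity alone, with no arithmetic input.
  - §2c `hasSum_norm_sq_of_windowTrace` (Bochner form on the half window),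
    `norm_sq_le_of_windowTrace` (UNIT MASS: one atom at `γ_j` costs `|ĝ(½+iγ_j)|² ≤ Q(g)`),
    `card_mul_norm_sq_le_of_windowTrace` (multiplicity `m(γ₀)·|ĝ(½+iγ₀)|² ≤ Q(g)`),
    `not_mem_range_of_windowTrace` (FORBIDDEN ZONE: `Q(g) < |ĝ(½+iγ₀)|²` for one half-window
    test excludes `γ₀` from every window family) — the integrality constraint that weighted
    Kreĭn realisations never feel; a construction must keep out of `{K_A > 1}`.
  - §2d `card_near_le_log_of_windowTrace` : LOCAL WEYL UPPER BOUND — at most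
    `C(1 + log(1+|T|))` points in `[T-1, T+1]`, `C = C(min(A, log 2))` uniform in `A ≥ log 2`
    (modulated narrow bump; Yoshida form of `Q`; `Re ψ(1/4+iu/2) ≤ 5 + log(1+|u|)`);
    `finite_near_of_windowTrace`, `finite_abs_le_of_windowTrace` (LOCAL FINITENESS of every
    witness). With §2b: the local density of any witness is squeezed between "unbounded" and
    `O(log T)` by the window identity alone.
* §3 WHY NO UNCONDITIONAL KILL EXISTS (kernel-checked here, no longer "modulo item 0193"):
  - `hasSum_weilMellin_zeros` : UNCONDITIONALLY the non-trivial zeros, repeated with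
    multiplicity, give `HasSum (p ↦ ĝ(ρ_p)) (W g)` for every Weil test — the relaxation
    "complex spectrum allowed" of the crux is a THEOREM; the reality of `γ` is the whole content.
  - `windowTrace_of_riemannHypothesis` : `RiemannHypothesis → WindowTrace A` for every `A`
    (at `A = log 2` this is the crux, `windowTraceArch_iff`); so
    `¬ WindowTraceArch → ¬ RiemannHypothesis` (`not_riemannHypothesis_of_not_windowTraceArch`).
    A disproof of the crux is a disproof of RH; cheap falsity search is meaningless here.
* §4 CERTIFIED LOW FORBIDDEN ZONE (cycle 2, namespace `…Cruxes.WindowTraceArch.LowZone` at the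
  end of this file; landing as `Theorems/WindowTraceArch/Negative/LowZone*.lean`, p83877 p83908 +2):
  `LowZone.eleven_le_abs_of_windowTraceArch_witness` — EVERY witness `γ` of the crux satisfies
  `|γ_i| ≥ 11` for ALL `i` (kernel-certified, axioms std; the first zero of `ζ` is `14.13…`);
  `LowZone.windowTraceArch_iff_far` (the crux ⇔ the crux with a family avoiding `(-11, 11)`);
  `LowZone.not_exists_windowTraceArch_witness_low` (the natural strengthening "a witness with a
  low-lying point" is FALSE). Mechanism = §2c unit mass + the UNCONDITIONAL zero side
  `Re Q(g) ≤ Σ_ρ m(ρ)‖ĝ(ρ)‖‖ĝ(1-ρ̄)‖` (`LowZone.re_weilQuadratic_le_tsum_zeroTerm`) + the tree's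
  kernel-certified zero data (29 bracketed simple zeros to height 101, Ford `Σ m/|ρ|² ≤ 0.0463`)
  + ONE test `g₀ = triangle(1/3) ⋆ bump(1/100)` with `ĝ₀(½+it) = (1/9) sinc²(t/6)·η̂`:
  `Re Q(g₀) ≤ 7.9·10⁻⁴ < 9.36·10⁻⁴ ≤ ‖ĝ₀(½+ir)‖²` for `|r| < 11`. The SAME comparison
  ("the witness μ and the zeta zeros have identical spectrograms g ↦ Σ|ĝ|² on half-window
  tests") gives explicit local COUNT bounds for witnesses near the bottom and, with sliding
  centres (modulated g₀), pushes the zone to ≈ 13.8 and pins an atom near 14.13 (numerics in the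
  refuter folder, numerics/lowzone.py; not yet formalised). Provers: build families with
  `|γ_i| ≥ 11` — you lose nothing (`windowTraceArch_iff_far`) and you must.
* §5 TARGETS (registered skeleton `Lines/defect_compactness_design.lean`, 5 stubs; read
  2026-08-16T06:40Z): no stub is cheaply false — `stub_base` (FL set `{|t| ≥ 7, cos θ(t) = 0}`
  enumerable with polynomial counts: TRUE; the cutoff 7 removes exactly the spurious pair
  `±0.8195` on the decreasing branch of `θ`; first points `±14.52`; proving `θ' > 0` on `[7,∞)`
  needs `reDigammaQuarter_mono` + ONE certified value `Re ψ(1/4+3.5i) > log π` — the tree's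
  `log_norm_sub_le_re_digamma` is too weak at `t = 7` (gives 0.99 < 1.1447)),
  `stub_acuteAngle` (= the tree's `Brouwer.exists_zero_of_bilin_coercive`, TRUE),
  `stub_compactness` (Tychonoff on `[-D,D]^ℕ` + Tannery, TRUE as typed: `C < 0` or `D < 0` only
  make it vacuous), `stub_extension` (dense countable family in `𝒟_K` + continuity of both
  functionals, TRUE), `stub_design` (the crux-strength core; bounded displacement of FL is what
  the zeta ordinates are under RH since `S(T) = O(log T)` × gap `2π/log T` = `O(1)`; NOT
  refutable here). §4 constrains every EXACT displaced family: `|x_n + δ_n| ≥ 11` for all `n`.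
  Remark for the lead on `ApproxArch → ApproxWindowTrace (log 2)` (card approximate-to-exact):
  RH-true, but the intended proof fails — the defect density is uncontrolled on the collar
  `A' < |t| < log 2`, where window tests need not be small relative to it.
* §6 NEXT: land LowZone parts 3–4; sliding-centre extension (zone → 13.8, atom pinned in
  `[13.8, 15.2]`); uniform low-lying point / lower local Weyl law (qualitative); attack stubs of
  the other two lines once registered (poisson-density-NK, causal-level-sets).

LANDED as importable modules
(`Summits.RiemannHypothesis.RiemannHypothesis.Theorems.WindowTraceArch.Negative.*`):
`FiniteSpectrum` (p72851), `WithoutIsWeilTest` (p73665), `ComplexSpectrum` (p73928),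
`BoundedDensity` (p73935), `UnitMass` (p73939), `LocalWeylTools` (p74325), `LocalWeyl` (p74752).
This work file re-proves everything inline so that it stands alone.
-/

noncomputable section

open Complex Filter Set MeasureTheory intervalIntegral
open scoped Real Topology ContDiff ComplexConjugate

namespace Summit.RiemannHypothesis.RiemannHypothesis.Cruxes.WindowTraceArch.Disproof

open Literature.NumberTheory.LFunctions
open Literature.Analysis.SpecialFunctions
open Summit.RiemannHypothesis.RiemannHypothesis.Theses.SpectralTrace

/-! ## §0 The window-trace predicate -/

/-- `WindowTrace A`: some real family `γ` reproduces the Weil functional on every Weil test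
supported in `[-A, A]` — the body of the crux with the half-width `log 2` replaced by `A`. -/
def WindowTrace (A : ℝ) : Prop :=
  ∃ (ι : Type) (γ : ι → ℝ), ∀ g : ℝ → ℂ, IsWeilTest g → tsupport g ⊆ Icc (-A) A →
    HasSum (fun i => weilMellin g (1 / 2 + (γ i : ℂ) * I)) (weilFunctional g)

/-- The crux is literally `WindowTrace (log 2)`. -/
theorem windowTraceArch_iff : WindowTraceArch ↔ WindowTrace (Real.log 2) := Iff.rfl

/-- Monotonicity of the ladder: a larger window is a stronger statement. -/
theorem WindowTrace.mono {A B : ℝ} (hAB : A ≤ B) (h : WindowTrace B) : WindowTrace A := by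
  obtain ⟨ι, γ, hγ⟩ := h
  exact ⟨ι, γ, fun g hg hgs => hγ g hg (hgs.trans (Icc_subset_Icc (by linarith) hAB))⟩

/-- The target `X` gives every rung. -/
theorem windowTrace_of_spectralThesis (h : SpectralThesis) (A : ℝ) : WindowTrace A := by
  obtain ⟨ι, γ, hγ⟩ := h
  exact ⟨ι, γ, fun g hg _ => hγ g hg⟩

/-- `W(0) = 0`. -/
theorem weilFunctional_zero : weilFunctional (0 : ℝ → ℂ) = 0 := by
  simp [weilFunctional, weilPolarTerm, weilPrimeTerm, weilArchTerm, weilArchIntegral, weilMellin]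

/-! ## §1 Load-bearing hypotheses -/

/-- The crux with the hypothesis `IsWeilTest g` DROPPED (all functions with support in the
window are tested). -/
def WindowTraceArchWithoutIsWeilTest : Prop :=
  ∃ (ι : Type) (γ : ι → ℝ), ∀ g : ℝ → ℂ, tsupport g ⊆ Icc (-Real.log 2) (Real.log 2) →
    HasSum (fun i => weilMellin g (1 / 2 + (γ i : ℂ) * I)) (weilFunctional g)

/-- The null spike `𝟙_{0}` (value `1` at `0`, `0` elsewhere). -/
def spike : ℝ → ℂ := Set.indicator {0} fun _ => 1

theorem spike_zero : spike 0 = 1 := by simp [spike]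

theorem spike_of_ne {t : ℝ} (ht : t ≠ 0) : spike t = 0 := by simp [spike, ht]

theorem tsupport_spike_subset : tsupport spike ⊆ ({0} : Set ℝ) :=
  closure_minimal (Set.support_indicator_subset) isClosed_singleton

/-- `weilMellin 𝟙_{0} ≡ 0`: the Mellin transform only sees the a.e.-class. -/
theorem weilMellin_spike (s : ℂ) : weilMellin spike s = 0 := by
  unfold weilMellin
  refine integral_eq_zero_of_ae ?_
  have hae : ∀ᵐ t : ℝ, t ∉ ({0} : Set ℝ) := compl_mem_ae_iff.2 (measure_singleton (0 : ℝ))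
  filter_upwards [hae] with t ht
  simp [spike_of_ne (by simpa using ht)]

/-- No prime power is seen by the spike (`log n = 0` only for `n = 0, 1`, where `Λ = 0`). -/
theorem weilPrimeTerm_spike : weilPrimeTerm spike = 0 := by
  unfold weilPrimeTerm
  refine (tsum_congr fun n => ?_).trans tsum_zero
  rcases Nat.lt_or_ge n 2 with hn | hn
  · interval_cases n <;> simp
  · have hlog : 0 < Real.log n := Real.log_pos (by exact_mod_cast hn)
    rw [spike_of_ne hlog.ne', spike_of_ne (by linarith : -Real.log n ≠ 0)]
    simp

/-- But the archimedean term reads the POINT VALUE `g 0`: `W(𝟙_{0}) = -log π ≠ 0`. -/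
theorem weilFunctional_spike : weilFunctional spike = -(Real.log π : ℂ) := by
  have hA : weilArchIntegral spike = 0 := by simp [weilArchIntegral, weilMellin_spike]
  simp [weilFunctional, weilPolarTerm, weilMellin_spike, weilPrimeTerm_spike, weilArchTerm, hA,
    spike_zero]

/-- **`IsWeilTest` is load-bearing.** Dropping it, the statement is false: the spike `𝟙_{0}`
has support in the window, `ĝ ≡ 0`, yet `W(𝟙_{0}) = -log π`. (The witness is a null
modification: `weilFunctional` depends on the point values `g 0`, `g (± log n)`, not only on the
distribution `g dt`; so every proof uses at least the continuity part of `IsWeilTest`. The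
`C^∞` part is used, in the RH-witness, only through two integrations by parts,
`norm_weilMellin_le`.) -/
theorem windowTraceArch_false_without_isWeilTest : ¬ WindowTraceArchWithoutIsWeilTest := by
  rintro ⟨ι, γ, h⟩
  have hlog2 : 0 ≤ Real.log 2 := Real.log_nonneg one_le_two
  have hsupp : tsupport spike ⊆ Icc (-Real.log 2) (Real.log 2) :=
    tsupport_spike_subset.trans (by
      rintro t rfl
      exact ⟨by linarith, hlog2⟩)
  have hsum := h spike hsupp
  simp only [weilMellin_spike] at hsum
  have h0 : weilFunctional spike = 0 := hsum.unique hasSum_zero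
  rw [weilFunctional_spike, neg_eq_zero, Complex.ofReal_eq_zero] at h0
  exact (Real.log_pos (by linarith [Real.pi_gt_three] : (1 : ℝ) < π)).ne' h0

/-- The crux with the SUPPORT hypothesis dropped. -/
def WindowTraceArchWithoutWindow : Prop :=
  ∃ (ι : Type) (γ : ι → ℝ), ∀ g : ℝ → ℂ, IsWeilTest g →
    HasSum (fun i => weilMellin g (1 / 2 + (γ i : ℂ) * I)) (weilFunctional g)

/-- **The window is load-bearing in the strongest sense**: without it the crux IS the route
target `X = SpectralThesis` (RH-equivalent in the tree: `X → RH` is the route's `Assembly`, by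
`weil_criterion_holds`; `RH → X` is `windowTrace_of_riemannHypothesis` below with the window
ignored). So this mutation cannot be refuted short of `¬ RH`. -/
theorem windowTraceArchWithoutWindow_iff_spectralThesis :
    WindowTraceArchWithoutWindow ↔ SpectralThesis := Iff.rfl

/-! ## §2 Small models: every witness is infinite; the empty family below `A ≤ 0` -/

/-- **Finite spectra are impossible at every window `A > 0`.** If a real family reproduces `W`
on the Weil tests supported in `[-A, A]`, its index type is infinite.
Proof: for `g` supported in `[-a, a]`, `a ≤ A/2`, the test `k = g ⋆ g̃` lies in the window and
`k̂(½+iγ) = |ĝ(½+iγ)|²` (`weilMellin_weilConv_weilReflect_half`), so `Q(g) = Σ_i |ĝ(½+iγ_i)|²`;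
each term is `≤ ‖g‖₁² ≤ 2a‖g‖₂²` (`norm_weilMellin_half_line_le`, `weilNorm1_sq_le`), whence
`Q(g) ≤ #ι · 2a ‖g‖₂²`, contradicting Bombieri's coercivity `Q(g) ≥ (#ι + 1)‖g‖₂²` for small
`a` (`weilQuadratic_coercive`) on the unit sphere (`exists_isWeilTest_sphere`). -/
theorem infinite_of_windowTrace {A : ℝ} (hA : 0 < A) {ι : Type*} {γ : ι → ℝ}
    (h : ∀ g : ℝ → ℂ, IsWeilTest g → tsupport g ⊆ Icc (-A) A →
      HasSum (fun i => weilMellin g (1 / 2 + (γ i : ℂ) * I)) (weilFunctional g)) :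
    Infinite ι := by
  by_contra hfin
  rw [not_infinite_iff_finite] at hfin
  cases nonempty_fintype ι
  set n : ℕ := Fintype.card ι with hn
  obtain ⟨a₀, ha₀, hco⟩ := weilQuadratic_coercive ((n : ℝ) + 1)
  set a : ℝ := min a₀ (min (1 / 2) (A / 2)) with ha_def
  have ha : 0 < a := lt_min ha₀ (lt_min one_half_pos (half_pos hA))
  have haa₀ : a ≤ a₀ := min_le_left _ _
  have ha2 : a ≤ 1 / 2 := (min_le_right _ _).trans (min_le_left _ _)
  have haA : a ≤ A / 2 := (min_le_right _ _).trans (min_le_right _ _)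
  obtain ⟨g, hg, hgs, hnorm⟩ := exists_isWeilTest_sphere ha
  -- coercivity on the unit sphere
  have hlow : ((n : ℝ) + 1) * ∫ t, ‖g t‖ ^ 2 ≤ (weilQuadratic g).re := hco a ha haa₀ g hg hgs
  rw [hnorm, mul_one] at hlow
  -- the trace identity for `k = g ⋆ g̃`
  have hk : IsWeilTest (weilConv g (weilReflect g)) := hg.weilConv hg.weilReflect
  have hks : tsupport (weilConv g (weilReflect g)) ⊆ Icc (-A) A :=
    (tsupport_weilConv_weilReflect_subset hg.2 hgs).trans
      (Icc_subset_Icc (by linarith) (by linarith))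
  have hsum := h _ hk hks
  have hsum' : HasSum (fun i => (((‖weilMellin g (1 / 2 + (γ i : ℂ) * I)‖ ^ 2 : ℝ) : ℂ)))
      (weilFunctional (weilConv g (weilReflect g))) := by
    simpa only [weilMellin_weilConv_weilReflect_half hg] using hsum
  have hQ : weilFunctional (weilConv g (weilReflect g)) =
      ∑ i, (((‖weilMellin g (1 / 2 + (γ i : ℂ) * I)‖ ^ 2 : ℝ) : ℂ)) :=
    hsum'.unique (hasSum_fintype _)
  -- each term is at most `2a ≤ 1`
  have h1 : weilNorm1 g ^ 2 ≤ 2 * a * weilNorm2Sq g := weilNorm1_sq_le hg ha hgs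
  have h2 : weilNorm2Sq g = 1 := hnorm
  have hterm : ∀ i, ‖weilMellin g (1 / 2 + (γ i : ℂ) * I)‖ ^ 2 ≤ 1 := by
    intro i
    have h3 := norm_weilMellin_half_line_le hg (γ i)
    have h4 : ‖weilMellin g (1 / 2 + (γ i : ℂ) * I)‖ ^ 2 ≤ weilNorm1 g ^ 2 :=
      pow_le_pow_left₀ (norm_nonneg _) h3 2
    nlinarith
  have hup : (weilQuadratic g).re ≤ n := by
    unfold weilQuadratic
    rw [hQ, Complex.re_sum]
    simp only [Complex.ofReal_re]
    calc ∑ i, ‖weilMellin g (1 / 2 + (γ i : ℂ) * I)‖ ^ 2 ≤ ∑ _i : ι, (1 : ℝ) :=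
          Finset.sum_le_sum fun i _ => hterm i
      _ = n := by simp [hn]
  linarith

/-- No FINITE real spectrum reproduces `W` on any window `A > 0` (in particular not on the
archimedean window `A = log 2`): the natural "small model" strengthening of the crux is false. -/
theorem not_windowTrace_finite {A : ℝ} (hA : 0 < A) :
    ¬ ∃ (ι : Type) (_ : Finite ι) (γ : ι → ℝ), ∀ g : ℝ → ℂ, IsWeilTest g →
      tsupport g ⊆ Icc (-A) A →
        HasSum (fun i => weilMellin g (1 / 2 + (γ i : ℂ) * I)) (weilFunctional g) := by
  rintro ⟨ι, hι, γ, h⟩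
  exact (infinite_of_windowTrace hA h).not_finite hι

/-- In particular for the crux window. -/
theorem not_windowTraceArch_finite :
    ¬ ∃ (ι : Type) (_ : Finite ι) (γ : ι → ℝ), ∀ g : ℝ → ℂ, IsWeilTest g →
      tsupport g ⊆ Icc (-Real.log 2) (Real.log 2) →
        HasSum (fun i => weilMellin g (1 / 2 + (γ i : ℂ) * I)) (weilFunctional g) :=
  not_windowTrace_finite (Real.log_pos one_lt_two)

/-- Any witness of the crux itself is an infinite family. -/
theorem infinite_of_windowTraceArch_witness {ι : Type} {γ : ι → ℝ}
    (h : ∀ g : ℝ → ℂ, IsWeilTest g → tsupport g ⊆ Icc (-Real.log 2) (Real.log 2) →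
      HasSum (fun i => weilMellin g (1 / 2 + (γ i : ℂ) * I)) (weilFunctional g)) :
    Infinite ι :=
  infinite_of_windowTrace (Real.log_pos one_lt_two) h

/-- **Tightness of `0 < A` in `infinite_of_windowTrace`**: for `A ≤ 0` the window carries only
`g = 0` (the support of a continuous `g` is open and sits inside `(-A, A) = ∅`), and the EMPTY
family is a witness. The ladder has content exactly for `A > 0`. -/
theorem windowTrace_of_nonpos {A : ℝ} (hA : A ≤ 0) : WindowTrace A := by
  refine ⟨PEmpty, fun i => i.elim, fun g hg hgs => ?_⟩
  have hsupp := support_subset_Ioo_of_tsupport_subset_Icc hg.1.continuous hgs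
  rw [Set.Ioo_eq_empty (by linarith : ¬ (-A < A)), Set.subset_empty_iff,
    Function.support_eq_empty_iff] at hsupp
  rw [hsupp, weilFunctional_zero]
  exact hasSum_empty

/-! ### §2b Density: no bounded local counting, no separated spectrum, no lattice -/

/-! #### An `L¹` Sobolev bound on unit intervals -/

/-- For `F` with a continuous derivative `F'` and `x ∈ [c, c+1]`:
`‖F x‖ ≤ ∫_c^{c+1} ‖F‖ + ∫_c^{c+1} ‖F'‖`. [folklore] -/
theorem norm_le_intervalIntegral_add {F F' : ℝ → ℂ} (hF : ∀ x, HasDerivAt F (F' x) x)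
    (hFc : Continuous F) (hF'c : Continuous F') {c x : ℝ} (hx : x ∈ Icc c (c + 1)) :
    ‖F x‖ ≤ (∫ y in c..c + 1, ‖F y‖) + ∫ y in c..c + 1, ‖F' y‖ := by
  have hc1 : c ≤ c + 1 := by linarith
  set J : ℝ := ∫ y in c..c + 1, ‖F' y‖ with hJ
  have hnn : 0 ≤ᵐ[volume.restrict (Ioc c (c + 1))] fun t => ‖F' t‖ :=
    Eventually.of_forall fun _ => norm_nonneg _
  -- pointwise in `y`: `‖F x‖ ≤ ‖F y‖ + J`
  have hpt : ∀ y ∈ Icc c (c + 1), ‖F x‖ ≤ ‖F y‖ + J := by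
    intro y hy
    have hFTC : ∫ t in y..x, F' t = F x - F y :=
      integral_eq_sub_of_hasDerivAt (fun t _ => hF t) (hF'c.intervalIntegrable _ _)
    have h1 : ‖F x - F y‖ ≤ J := by
      rw [← hFTC]
      rcases le_total y x with hyx | hxy
      · calc ‖∫ t in y..x, F' t‖ ≤ ∫ t in y..x, ‖F' t‖ := norm_integral_le_integral_norm hyx
          _ ≤ J := integral_mono_interval hy.1 hyx hx.2 hnn (hF'c.norm.intervalIntegrable _ _)
      · rw [integral_symm, norm_neg]
        calc ‖∫ t in x..y, F' t‖ ≤ ∫ t in x..y, ‖F' t‖ := norm_integral_le_integral_norm hxy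
          _ ≤ J := integral_mono_interval hx.1 hxy hy.2 hnn (hF'c.norm.intervalIntegrable _ _)
    calc ‖F x‖ = ‖F y + (F x - F y)‖ := by rw [add_sub_cancel]
      _ ≤ ‖F y‖ + ‖F x - F y‖ := norm_add_le _ _
      _ ≤ ‖F y‖ + J := by linarith
  -- integrate over `y ∈ [c, c+1]`
  have hint : (∫ _ in c..c + 1, ‖F x‖) ≤ ∫ y in c..c + 1, (‖F y‖ + J) :=
    integral_mono_on hc1 intervalIntegrable_const
      ((hFc.norm.intervalIntegrable _ _).add intervalIntegrable_const) hpt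
  rw [intervalIntegral.integral_const,
    intervalIntegral.integral_add (hFc.norm.intervalIntegrable _ _) intervalIntegrable_const,
    intervalIntegral.integral_const] at hint
  simpa using hint

/-- The square of a `C¹` function on a unit interval:
`‖f x‖² ≤ ∫_c^{c+1} (2‖f‖² + ‖f'‖²)` for `x ∈ [c, c+1]` (apply the `L¹` bound to `F = f²`,
`F' = 2 f f'`, and `2|f||f'| ≤ |f|² + |f'|²`). [folklore] -/
theorem norm_sq_le_intervalIntegral {f f' : ℝ → ℂ} (hf : ∀ x, HasDerivAt f (f' x) x)
    (hfc : Continuous f) (hf'c : Continuous f') {c x : ℝ} (hx : x ∈ Icc c (c + 1)) :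
    ‖f x‖ ^ 2 ≤ ∫ y in c..c + 1, (2 * ‖f y‖ ^ 2 + ‖f' y‖ ^ 2) := by
  have hc1 : c ≤ c + 1 := by linarith
  have hF : ∀ x, HasDerivAt (fun y => f y * f y) (f' x * f x + f x * f' x) x := fun x =>
    (hf x).mul (hf x)
  have h := norm_le_intervalIntegral_add hF (hfc.mul hfc) ((hf'c.mul hfc).add (hfc.mul hf'c)) hx
  rw [norm_mul, ← sq] at h
  refine h.trans ?_
  have hi1 : IntervalIntegrable (fun y => ‖f y * f y‖) volume c (c + 1) :=
    (hfc.mul hfc).norm.intervalIntegrable _ _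
  have hi2 : IntervalIntegrable (fun y => ‖f' y * f y + f y * f' y‖) volume c (c + 1) :=
    ((hf'c.mul hfc).add (hfc.mul hf'c)).norm.intervalIntegrable _ _
  rw [← intervalIntegral.integral_add hi1 hi2]
  refine intervalIntegral.integral_mono_on hc1 (hi1.add hi2) ?_ fun y _ => ?_
  · exact ((continuous_const.mul (hfc.norm.pow 2)).add (hf'c.norm.pow 2)).intervalIntegrable _ _
  · have h2 : ‖f' y * f y + f y * f' y‖ ≤ ‖f' y‖ * ‖f y‖ + ‖f y‖ * ‖f' y‖ :=
      (norm_add_le _ _).trans (by rw [norm_mul, norm_mul])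
    rw [norm_mul, ← sq]
    nlinarith [sq_nonneg (‖f y‖ - ‖f' y‖), norm_nonneg (f y), norm_nonneg (f' y)]

/-! #### The derivative of `u ↦ ĝ(1/2 + iu)` -/

/-- `t ↦ t g(t)` is a Weil test function. [folklore] -/
theorem isWeilTest_mul_id {g : ℝ → ℂ} (hg : IsWeilTest g) : IsWeilTest fun t : ℝ => (t : ℂ) * g t :=
  ⟨Complex.ofRealCLM.contDiff.mul hg.1, hg.2.mul_left⟩

/-- `d/du ĝ(1/2 + iu) = i · (t g)^(1/2 + iu)`. [folklore] -/
theorem hasDerivAt_weilMellin_line {g : ℝ → ℂ} (hg : IsWeilTest g) (u : ℝ) :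
    HasDerivAt (fun v : ℝ => weilMellin g (1 / 2 + v * I))
      (I * weilMellin (fun t : ℝ => (t : ℂ) * g t) (1 / 2 + u * I)) u := by
  have h1 : HasDerivAt (fun v : ℝ => (1 / 2 : ℂ) + (v : ℂ) * I) I u := by
    simpa using ((hasDerivAt_id u).ofReal_comp.mul_const I).const_add (1 / 2 : ℂ)
  have h2 := hasDerivAt_weilMellin hg.1.continuous hg.2 (1 / 2 + u * I)
  have h3 : HasDerivAt (weilMellin g ∘ fun v : ℝ => (1 / 2 : ℂ) + (v : ℂ) * I)
      ((∫ t : ℝ, g t * (t * cexp ((1 / 2 + u * I - 1 / 2) * t))) * I) u := h2.comp u h1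
  have h4 : HasDerivAt (fun v : ℝ => weilMellin g (1 / 2 + v * I))
      ((∫ t : ℝ, g t * (t * cexp ((1 / 2 + u * I - 1 / 2) * t))) * I) u := h3
  refine h4.congr_deriv ?_
  rw [mul_comm, weilMellin]
  congr 1
  refine integral_congr_ae (Eventually.of_forall fun t => ?_)
  simp only
  ring

/-! #### No window-trace family has bounded local counting -/

/-- **A window-trace family has unbounded local counting.** If a real family `γ : ι → ℝ`
reproduces the Weil functional on every Weil test supported in `[-A, A]` (`A > 0`), then for
every `D : ℕ` some unit cell `[k, k+1)` (`k ∈ ℤ`) contains more than `D` points of the family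
(precisely: it is false that every cell's points fit in a finset of size `≤ D`). In particular
the spectrum is not uniformly discrete, not a finite union of lattices, and not of bounded
Beurling upper density: the log-growth of the local density is forced.
Proof: with `f(u) = ĝ(1/2+iu)`, the `L¹` Sobolev bound on unit cells gives
`Σ_i |f(γ_i)|² ≤ D ∫ (2|f|² + |f'|²) = 2πD (2‖g‖₂² + ‖t g‖₂²) ≤ 6πD ‖g‖₂²` for `supp g ⊆ [-a,a]`,
`a ≤ 1` (Plancherel `integral_norm_sq_weilMellin_half_line`), while `Σ_i |f(γ_i)|² = Q(g)`
(`weilMellin_weilConv_weilReflect_half`) and `Q(g) ≥ (19 D + 1)‖g‖₂²` for `a` small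
(`weilQuadratic_coercive`). [folklore] -/
theorem not_bounded_localCount_of_windowTrace {A : ℝ} (hA : 0 < A) {ι : Type*} {γ : ι → ℝ}
    (h : ∀ g : ℝ → ℂ, IsWeilTest g → tsupport g ⊆ Icc (-A) A →
      HasSum (fun i => weilMellin g (1 / 2 + (γ i : ℂ) * I)) (weilFunctional g)) (D : ℕ) :
    ¬ ∀ k : ℤ, ∃ s : Finset ι, s.card ≤ D ∧ ∀ i, γ i ∈ Set.Ico (k : ℝ) (k + 1) → i ∈ s := by
  intro hD
  classical
  choose S hScard hSmem using hD
  -- a thin test on the unit sphere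
  obtain ⟨a₀, ha₀, hco⟩ := weilQuadratic_coercive (19 * (D : ℝ) + 1)
  set a : ℝ := min a₀ (min 1 (A / 2)) with ha_def
  have ha : 0 < a := lt_min ha₀ (lt_min one_pos (half_pos hA))
  have haa₀ : a ≤ a₀ := min_le_left _ _
  have ha1 : a ≤ 1 := (min_le_right _ _).trans (min_le_left _ _)
  have haA : a ≤ A / 2 := (min_le_right _ _).trans (min_le_right _ _)
  obtain ⟨g, hg, hgs, hnorm⟩ := exists_isWeilTest_sphere ha
  have hN : weilNorm2Sq g = 1 := hnorm
  -- coercivity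
  have hlow : (19 * (D : ℝ) + 1) * ∫ t, ‖g t‖ ^ 2 ≤ (weilQuadratic g).re := hco a ha haa₀ g hg hgs
  rw [hnorm, mul_one] at hlow
  -- the trace identity for `k = g ⋆ g̃`, in real form
  have hk : IsWeilTest (weilConv g (weilReflect g)) := hg.weilConv hg.weilReflect
  have hks : tsupport (weilConv g (weilReflect g)) ⊆ Icc (-A) A :=
    (tsupport_weilConv_weilReflect_subset hg.2 hgs).trans
      (Icc_subset_Icc (by linarith) (by linarith))
  have hsumC : HasSum (fun i => (((‖weilMellin g (1 / 2 + (γ i : ℂ) * I)‖ ^ 2 : ℝ) : ℂ)))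
      (weilFunctional (weilConv g (weilReflect g))) := by
    simpa only [weilMellin_weilConv_weilReflect_half hg] using h _ hk hks
  have hsumR : HasSum (fun i => ‖weilMellin g (1 / 2 + (γ i : ℂ) * I)‖ ^ 2)
      (weilFunctional (weilConv g (weilReflect g))).re := by
    simpa only [Complex.reCLM_apply, Complex.ofReal_re] using hsumC.mapL Complex.reCLM
  rw [weilQuadratic] at hlow
  -- notation for the line function and its derivative
  set f : ℝ → ℂ := fun v => weilMellin g (1 / 2 + v * I) with hf_def
  set gh : ℝ → ℂ := fun t => (t : ℂ) * g t with hgh_def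
  have hgh : IsWeilTest gh := isWeilTest_mul_id hg
  set f' : ℝ → ℂ := fun v => I * weilMellin gh (1 / 2 + v * I) with hf'_def
  have hder : ∀ v, HasDerivAt f (f' v) v := fun v => hasDerivAt_weilMellin_line hg v
  have hfc : Continuous f :=
    (continuous_weilMellin hg.1.continuous hg.2).comp (by fun_prop)
  have hf'c : Continuous f' :=
    continuous_const.mul ((continuous_weilMellin hgh.1.continuous hgh.2).comp (by fun_prop))
  set φ : ℝ → ℝ := fun v => 2 * ‖f v‖ ^ 2 + ‖f' v‖ ^ 2 with hφ_def
  have hφc : Continuous φ := (continuous_const.mul (hfc.norm.pow 2)).add (hf'c.norm.pow 2)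
  have hφnn : ∀ v, 0 ≤ φ v := fun v => by positivity
  -- integrability and the value of `∫ φ`
  have hif : Integrable fun v => ‖f v‖ ^ 2 := integrable_norm_sq_weilMellin_half_line hg
  have hif' : Integrable fun v => ‖f' v‖ ^ 2 := by
    have := integrable_norm_sq_weilMellin_half_line hgh
    refine this.congr (Eventually.of_forall fun v => ?_)
    simp [hf'_def]
  have hiφ : Integrable φ := (hif.const_mul 2).add hif'
  have hgh2 : weilNorm2Sq gh ≤ a ^ 2 * weilNorm2Sq g := by
    unfold weilNorm2Sq
    rw [← MeasureTheory.integral_const_mul]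
    refine integral_mono hgh.integrable_norm_sq (hg.integrable_norm_sq.const_mul _) fun t => ?_
    · by_cases ht : t ∈ tsupport g
      · have ht' := hgs ht
        simp only [hgh_def, norm_mul, Complex.norm_real, Real.norm_eq_abs, mul_pow, sq_abs]
        have : t ^ 2 ≤ a ^ 2 := by nlinarith [ht'.1, ht'.2]
        exact mul_le_mul_of_nonneg_right this (sq_nonneg _)
      · simp [hgh_def, image_eq_zero_of_notMem_tsupport ht]
  have hB : ∫ v, φ v ≤ 19 := by
    have e1 : ∫ v, ‖f v‖ ^ 2 = 2 * π * weilNorm2Sq g := integral_norm_sq_weilMellin_half_line hg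
    have e2 : ∫ v, ‖f' v‖ ^ 2 = 2 * π * weilNorm2Sq gh := by
      rw [← integral_norm_sq_weilMellin_half_line hgh]
      refine integral_congr_ae (Eventually.of_forall fun v => ?_)
      simp [hf'_def]
    show ∫ v, (2 * ‖f v‖ ^ 2 + ‖f' v‖ ^ 2) ≤ 19
    rw [integral_add (hif.const_mul 2) hif', MeasureTheory.integral_const_mul, e1, e2, hN]
    have hpi := Real.pi_lt_d2
    have hgh2' : weilNorm2Sq gh ≤ 1 := by nlinarith
    nlinarith [Real.pi_pos, weilNorm1_nonneg gh]
  -- the cells: `b k = ∫_k^{k+1} φ`, summing to `∫ φ`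
  set b : ℤ → ℝ := fun k => ∫ v in (k : ℝ)..(k : ℝ) + 1, φ v with hb_def
  have hb_nonneg : ∀ k, 0 ≤ b k := fun k =>
    intervalIntegral.integral_nonneg (by linarith) fun v _ => hφnn v
  have hbsum : HasSum b (∫ v, φ v) := by
    have h1 := hasSum_integral_iUnion (μ := volume) (f := φ)
      (s := fun k : ℤ => Ioc (k : ℝ) (k + 1)) (fun k => measurableSet_Ioc)
      (pairwise_disjoint_Ioc_intCast ℝ) (hiφ.integrableOn)
    rw [iUnion_Ioc_intCast, setIntegral_univ] at h1
    refine h1.congr_fun fun k => ?_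
    show (∫ v in (k : ℝ)..(k : ℝ) + 1, φ v) = ∫ v in Ioc (k : ℝ) (k + 1), φ v
    exact intervalIntegral.integral_of_le (by linarith)
  -- pointwise Sobolev: `‖f x‖² ≤ b ⌊x⌋`
  have hpt : ∀ x : ℝ, ‖f x‖ ^ 2 ≤ b ⌊x⌋ := fun x =>
    norm_sq_le_intervalIntegral hder hfc hf'c
      ⟨Int.floor_le x, (Int.lt_floor_add_one x).le⟩
  -- finite partial sums are `≤ D · ∫ φ`
  have hfin : ∀ s : Finset ι, ∑ i ∈ s, ‖f (γ i)‖ ^ 2 ≤ D * ∫ v, φ v := by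
    intro s
    set t : Finset ℤ := s.image fun i => ⌊γ i⌋ with ht_def
    have hmaps : ∀ i ∈ s, ⌊γ i⌋ ∈ t := fun i hi => Finset.mem_image_of_mem _ hi
    rw [← Finset.sum_fiberwise_of_maps_to hmaps]
    calc ∑ k ∈ t, ∑ i ∈ s with ⌊γ i⌋ = k, ‖f (γ i)‖ ^ 2
        ≤ ∑ k ∈ t, ∑ i ∈ s with ⌊γ i⌋ = k, b k := by
          refine Finset.sum_le_sum fun k _ => Finset.sum_le_sum fun i hi => ?_
          rw [Finset.mem_filter] at hi
          rw [← hi.2]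
          exact hpt (γ i)
      _ = ∑ k ∈ t, ((s.filter fun i => ⌊γ i⌋ = k).card : ℝ) * b k := by
          simp [Finset.sum_const, nsmul_eq_mul]
      _ ≤ ∑ k ∈ t, (D : ℝ) * b k := by
          refine Finset.sum_le_sum fun k _ => mul_le_mul_of_nonneg_right ?_ (hb_nonneg k)
          have hsub : (s.filter fun i => ⌊γ i⌋ = k) ⊆ S k := by
            intro i hi
            rw [Finset.mem_filter] at hi
            exact hSmem k i (Int.floor_eq_iff.1 hi.2)
          exact_mod_cast (Finset.card_le_card hsub).trans (hScard k)
      _ = (D : ℝ) * ∑ k ∈ t, b k := by rw [Finset.mul_sum]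
      _ ≤ (D : ℝ) * ∫ v, φ v :=
          mul_le_mul_of_nonneg_left (sum_le_hasSum t (fun k _ => hb_nonneg k) hbsum)
            (Nat.cast_nonneg D)
  -- hence `Q(g) ≤ 19 D`, contradicting coercivity
  have hup : (weilFunctional (weilConv g (weilReflect g))).re ≤ D * ∫ v, φ v :=
    hasSum_le_of_sum_le hsumR hfin
  have hD19 : (D : ℝ) * ∫ v, φ v ≤ D * 19 := mul_le_mul_of_nonneg_left hB (Nat.cast_nonneg D)
  linarith

/-! #### Corollaries: crowded cells; no separated (uniformly discrete) spectrum; no lattice -/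

/-- **Some unit cell is arbitrarily crowded.** For a window-trace family and every `D`, there
is a cell `[k, k+1)` whose indices fit in no finset of size `≤ D` (the cell holds more than
`D` points, or infinitely many). [folklore] -/
theorem exists_crowded_cell_of_windowTrace {A : ℝ} (hA : 0 < A) {ι : Type*} {γ : ι → ℝ}
    (h : ∀ g : ℝ → ℂ, IsWeilTest g → tsupport g ⊆ Icc (-A) A →
      HasSum (fun i => weilMellin g (1 / 2 + (γ i : ℂ) * I)) (weilFunctional g)) (D : ℕ) :
    ∃ k : ℤ, ∀ s : Finset ι, (∀ i, γ i ∈ Set.Ico (k : ℝ) (k + 1) → i ∈ s) → D < s.card := by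
  by_contra hcon
  refine not_bounded_localCount_of_windowTrace hA h D fun k => ?_
  obtain ⟨s, hs⟩ := not_forall.1 (not_exists.1 hcon k)
  obtain ⟨hmem, hcard⟩ := Classical.not_imp.1 hs
  exact ⟨s, not_lt.1 hcard, hmem⟩

/-- A `δ`-separated real family has at most `⌊1/δ⌋₊ + 1` points in each unit cell
(pigeonhole on `i ↦ ⌊(γ_i - k)/δ⌋₊`). [folklore] -/
theorem exists_finset_cell_of_separated {ι : Type*} {γ : ι → ℝ} {δ : ℝ} (hδ : 0 < δ)
    (hsep : Pairwise fun i j => δ ≤ |γ i - γ j|) (k : ℤ) :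
    ∃ s : Finset ι, s.card ≤ ⌊1 / δ⌋₊ + 1 ∧ ∀ i, γ i ∈ Set.Ico (k : ℝ) (k + 1) → i ∈ s := by
  classical
  set C : Set ι := {i | γ i ∈ Set.Ico (k : ℝ) (k + 1)} with hC
  set φ : ι → ℕ := fun i => ⌊(γ i - k) / δ⌋₊ with hφ
  have hinj : Set.InjOn φ C := by
    intro i hi j hj hij
    by_contra hne
    have hs : δ ≤ |γ i - γ j| := hsep hne
    have hi0 : 0 ≤ (γ i - k) / δ := div_nonneg (by linarith [hi.1]) hδ.le
    have hj0 : 0 ≤ (γ j - k) / δ := div_nonneg (by linarith [hj.1]) hδ.le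
    obtain ⟨h1, h2⟩ := (Nat.floor_eq_iff hi0).1 rfl
    obtain ⟨h3, h4⟩ := (Nat.floor_eq_iff hj0).1 rfl
    have hij' : (⌊(γ i - k) / δ⌋₊ : ℝ) = ⌊(γ j - k) / δ⌋₊ := by exact_mod_cast hij
    have hlt : |(γ i - k) / δ - (γ j - k) / δ| < 1 := by
      rw [abs_lt]; constructor <;> linarith
    have heq : (γ i - k) / δ - (γ j - k) / δ = (γ i - γ j) / δ := by ring
    rw [heq, abs_div, abs_of_pos hδ, div_lt_one hδ] at hlt
    linarith
  have hmaps : Set.MapsTo φ C (Finset.range (⌊1 / δ⌋₊ + 1) : Finset ℕ) := by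
    intro i hi
    rw [Finset.coe_range, Set.mem_Iio, Nat.lt_add_one_iff]
    refine Nat.floor_le_floor ?_
    rw [div_le_div_iff_of_pos_right hδ]
    linarith [hi.2]
  have hfin : C.Finite :=
    Set.Finite.of_finite_image ((Finset.finite_toSet _).subset hmaps.image_subset) hinj
  refine ⟨hfin.toFinset, ?_, fun i hi => hfin.mem_toFinset.2 hi⟩
  have hcard := Finset.card_le_card_of_injOn φ (s := hfin.toFinset)
    (t := Finset.range (⌊1 / δ⌋₊ + 1)) (fun i hi => hmaps (hfin.mem_toFinset.1 hi))
    (fun i hi j hj hij => hinj (hfin.mem_toFinset.1 hi) (hfin.mem_toFinset.1 hj) hij)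
  simpa using hcard

/-- **No uniformly discrete (separated) spectrum.** A window-trace family (`A > 0`) is never
`δ`-separated for any `δ > 0`: in particular it is not a Delone set, not a finite-density model
set / Fourier quasicrystal with uniformly discrete support, and (next lemma) not a lattice.
[folklore] -/
theorem not_separated_of_windowTrace {A : ℝ} (hA : 0 < A) {ι : Type*} {γ : ι → ℝ}
    (h : ∀ g : ℝ → ℂ, IsWeilTest g → tsupport g ⊆ Icc (-A) A →
      HasSum (fun i => weilMellin g (1 / 2 + (γ i : ℂ) * I)) (weilFunctional g))
    {δ : ℝ} (hδ : 0 < δ) : ¬ Pairwise fun i j => δ ≤ |γ i - γ j| := fun hsep =>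
  not_bounded_localCount_of_windowTrace hA h (⌊1 / δ⌋₊ + 1)
    (exists_finset_cell_of_separated hδ hsep)

/-- **No lattice / arithmetic progression `a + bℤ` (`b ≠ 0`) is a window-trace family**
(Poisson summation would make its transform a Dirac comb; here it falls to the separation
bound directly). [folklore] -/
theorem not_windowTrace_lattice {A : ℝ} (hA : 0 < A) (a b : ℝ) (hb : b ≠ 0) :
    ¬ ∀ g : ℝ → ℂ, IsWeilTest g → tsupport g ⊆ Icc (-A) A →
      HasSum (fun n : ℤ => weilMellin g (1 / 2 + ((a + b * n : ℝ) : ℂ) * I))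
        (weilFunctional g) := by
  intro h
  refine not_separated_of_windowTrace hA (γ := fun n : ℤ => a + b * n) h (abs_pos.2 hb) ?_
  intro i j hij
  have h1 : (1 : ℝ) ≤ |(i : ℝ) - j| := by
    rw [← Int.cast_sub, ← Int.cast_abs]
    exact_mod_cast Int.one_le_abs (sub_ne_zero.2 hij)
  have h2 : |(a + b * i) - (a + b * j)| = |b| * |(i : ℝ) - j| := by
    rw [← abs_mul]; congr 1; ring
  rw [h2]
  nlinarith [abs_nonneg b]

/-- The crux window `[-log 2, log 2]`: no bounded local counting, no separated spectrum,
no lattice. [folklore] -/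
theorem not_separated_of_windowTraceArch_witness {ι : Type} {γ : ι → ℝ}
    (h : ∀ g : ℝ → ℂ, IsWeilTest g → tsupport g ⊆ Icc (-Real.log 2) (Real.log 2) →
      HasSum (fun i => weilMellin g (1 / 2 + (γ i : ℂ) * I)) (weilFunctional g))
    {δ : ℝ} (hδ : 0 < δ) : ¬ Pairwise fun i j => δ ≤ |γ i - γ j| :=
  not_separated_of_windowTrace (Real.log_pos one_lt_two) h hδ

theorem exists_crowded_cell_of_windowTraceArch_witness {ι : Type} {γ : ι → ℝ}
    (h : ∀ g : ℝ → ℂ, IsWeilTest g → tsupport g ⊆ Icc (-Real.log 2) (Real.log 2) →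
      HasSum (fun i => weilMellin g (1 / 2 + (γ i : ℂ) * I)) (weilFunctional g)) (D : ℕ) :
    ∃ k : ℤ, ∀ s : Finset ι, (∀ i, γ i ∈ Set.Ico (k : ℝ) (k + 1) → i ∈ s) → D < s.card :=
  exists_crowded_cell_of_windowTrace (Real.log_pos one_lt_two) h D

theorem not_windowTraceArch_lattice (a b : ℝ) (hb : b ≠ 0) :
    ¬ ∀ g : ℝ → ℂ, IsWeilTest g → tsupport g ⊆ Icc (-Real.log 2) (Real.log 2) →
      HasSum (fun n : ℤ => weilMellin g (1 / 2 + ((a + b * n : ℝ) : ℂ) * I))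
        (weilFunctional g) :=
  not_windowTrace_lattice (Real.log_pos one_lt_two) a b hb


/-! ### §2c Unit masses: the spectral exclusion (forbidden zone) inequality -/

section UnitMass

variable {A : ℝ} {ι : Type*} {γ : ι → ℝ} {g : ℝ → ℂ}

/-- **Bochner form of the window trace on the half window.** For a window-trace family and a
Weil test `g` supported in `[-A/2, A/2]`: `HasSum (i ↦ |ĝ(1/2+iγ_i)|²) (Re Q(g))`. [folklore] -/
theorem hasSum_norm_sq_of_windowTrace
    (h : ∀ g : ℝ → ℂ, IsWeilTest g → tsupport g ⊆ Icc (-A) A →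
      HasSum (fun i => weilMellin g (1 / 2 + (γ i : ℂ) * I)) (weilFunctional g))
    (hg : IsWeilTest g) (hgs : tsupport g ⊆ Icc (-(A / 2)) (A / 2)) :
    HasSum (fun i => ‖weilMellin g (1 / 2 + (γ i : ℂ) * I)‖ ^ 2) (weilQuadratic g).re := by
  have hk : IsWeilTest (weilConv g (weilReflect g)) := hg.weilConv hg.weilReflect
  have hks : tsupport (weilConv g (weilReflect g)) ⊆ Icc (-A) A :=
    (tsupport_weilConv_weilReflect_subset hg.2 hgs).trans
      (Icc_subset_Icc (by linarith) (by linarith))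
  have hsumC : HasSum (fun i => (((‖weilMellin g (1 / 2 + (γ i : ℂ) * I)‖ ^ 2 : ℝ) : ℂ)))
      (weilFunctional (weilConv g (weilReflect g))) := by
    simpa only [weilMellin_weilConv_weilReflect_half hg] using h _ hk hks
  have hsumR : HasSum (fun i => ‖weilMellin g (1 / 2 + (γ i : ℂ) * I)‖ ^ 2)
      (weilFunctional (weilConv g (weilReflect g))).re := by
    simpa only [Complex.reCLM_apply, Complex.ofReal_re] using hsumC.mapL Complex.reCLM
  unfold weilQuadratic
  exact hsumR

/-- Every finite partial sum of the squared transform is bounded by the energy `Re Q(g)`.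
[folklore] -/
theorem sum_norm_sq_le_of_windowTrace
    (h : ∀ g : ℝ → ℂ, IsWeilTest g → tsupport g ⊆ Icc (-A) A →
      HasSum (fun i => weilMellin g (1 / 2 + (γ i : ℂ) * I)) (weilFunctional g))
    (hg : IsWeilTest g) (hgs : tsupport g ⊆ Icc (-(A / 2)) (A / 2)) (s : Finset ι) :
    ∑ i ∈ s, ‖weilMellin g (1 / 2 + (γ i : ℂ) * I)‖ ^ 2 ≤ (weilQuadratic g).re :=
  sum_le_hasSum s (fun _ _ => by positivity) (hasSum_norm_sq_of_windowTrace h hg hgs)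

/-- **Unit masses**: a single atom at `γ_j` already costs `|ĝ(1/2+iγ_j)|² ≤ Re Q(g)` for
every half-window test `g`. [folklore] -/
theorem norm_sq_le_of_windowTrace
    (h : ∀ g : ℝ → ℂ, IsWeilTest g → tsupport g ⊆ Icc (-A) A →
      HasSum (fun i => weilMellin g (1 / 2 + (γ i : ℂ) * I)) (weilFunctional g))
    (hg : IsWeilTest g) (hgs : tsupport g ⊆ Icc (-(A / 2)) (A / 2)) (j : ι) :
    ‖weilMellin g (1 / 2 + (γ j : ℂ) * I)‖ ^ 2 ≤ (weilQuadratic g).re := by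
  simpa using sum_norm_sq_le_of_windowTrace h hg hgs {j}

/-- **Multiplicity bound**: if `s` is a finite set of indices all carrying the value `γ₀`,
then `#s · |ĝ(1/2+iγ₀)|² ≤ Re Q(g)` (so the multiplicity of `γ₀` is at most
`Re Q(g) / |ĝ(1/2+iγ₀)|²` for every half-window test). [folklore] -/
theorem card_mul_norm_sq_le_of_windowTrace
    (h : ∀ g : ℝ → ℂ, IsWeilTest g → tsupport g ⊆ Icc (-A) A →
      HasSum (fun i => weilMellin g (1 / 2 + (γ i : ℂ) * I)) (weilFunctional g))
    (hg : IsWeilTest g) (hgs : tsupport g ⊆ Icc (-(A / 2)) (A / 2)) {γ₀ : ℝ} (s : Finset ι)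
    (hs : ∀ i ∈ s, γ i = γ₀) :
    (s.card : ℝ) * ‖weilMellin g (1 / 2 + (γ₀ : ℂ) * I)‖ ^ 2 ≤ (weilQuadratic g).re := by
  have h1 := sum_norm_sq_le_of_windowTrace h hg hgs s
  have h2 : ∑ i ∈ s, ‖weilMellin g (1 / 2 + (γ i : ℂ) * I)‖ ^ 2 =
      ∑ _i ∈ s, ‖weilMellin g (1 / 2 + (γ₀ : ℂ) * I)‖ ^ 2 :=
    Finset.sum_congr rfl fun i hi => by rw [hs i hi]
  rw [h2, Finset.sum_const, nsmul_eq_mul] at h1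
  exact h1

/-- **Forbidden zone.** If some Weil test `g` supported in `[-A/2, A/2]` has
`Re Q(g) < |ĝ(1/2+iγ₀)|²`, then `γ₀` is a value of NO family reproducing `W` on `[-A, A]`.
[folklore] -/
theorem not_mem_range_of_windowTrace
    (h : ∀ g : ℝ → ℂ, IsWeilTest g → tsupport g ⊆ Icc (-A) A →
      HasSum (fun i => weilMellin g (1 / 2 + (γ i : ℂ) * I)) (weilFunctional g))
    (hg : IsWeilTest g) (hgs : tsupport g ⊆ Icc (-(A / 2)) (A / 2)) {γ₀ : ℝ}
    (hlt : (weilQuadratic g).re < ‖weilMellin g (1 / 2 + (γ₀ : ℂ) * I)‖ ^ 2) :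
    γ₀ ∉ Set.range γ := by
  rintro ⟨j, rfl⟩
  exact not_lt.2 (norm_sq_le_of_windowTrace h hg hgs j) hlt

/-- The crux window `A = log 2`: forbidden zone for `WindowTraceArch` witnesses from tests
supported in `[-(log 2)/2, (log 2)/2]`. [folklore] -/
theorem not_mem_range_of_windowTraceArch_witness {ι : Type} {γ : ι → ℝ}
    (h : ∀ g : ℝ → ℂ, IsWeilTest g → tsupport g ⊆ Icc (-Real.log 2) (Real.log 2) →
      HasSum (fun i => weilMellin g (1 / 2 + (γ i : ℂ) * I)) (weilFunctional g))
    {g : ℝ → ℂ} (hg : IsWeilTest g)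
    (hgs : tsupport g ⊆ Icc (-(Real.log 2 / 2)) (Real.log 2 / 2)) {γ₀ : ℝ}
    (hlt : (weilQuadratic g).re < ‖weilMellin g (1 / 2 + (γ₀ : ℂ) * I)‖ ^ 2) :
    γ₀ ∉ Set.range γ :=
  not_mem_range_of_windowTrace h hg hgs hlt

/-- The crux window: multiplicity bound for `WindowTraceArch` witnesses. [folklore] -/
theorem card_mul_norm_sq_le_of_windowTraceArch_witness {ι : Type} {γ : ι → ℝ}
    (h : ∀ g : ℝ → ℂ, IsWeilTest g → tsupport g ⊆ Icc (-Real.log 2) (Real.log 2) →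
      HasSum (fun i => weilMellin g (1 / 2 + (γ i : ℂ) * I)) (weilFunctional g))
    {g : ℝ → ℂ} (hg : IsWeilTest g)
    (hgs : tsupport g ⊆ Icc (-(Real.log 2 / 2)) (Real.log 2 / 2)) {γ₀ : ℝ} (s : Finset ι)
    (hs : ∀ i ∈ s, γ i = γ₀) :
    (s.card : ℝ) * ‖weilMellin g (1 / 2 + (γ₀ : ℂ) * I)‖ ^ 2 ≤ (weilQuadratic g).re :=
  card_mul_norm_sq_le_of_windowTrace h hg hgs s hs

end UnitMass

/-! ### §2d The local Weyl law: at most `O(log T)` points per unit interval; local finiteness -/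

/-! #### An upper bound for the archimedean weight `Re ψ(1/4 + iu/2)` -/

/-- `Re ψ(1/4 + iu/2) ≤ 5 + log(1 + |u|)` for all real `u` (Stirling-type bound
`re_digamma_le_log_norm_add` for `|u| ≥ 1`, monotonicity `reDigammaQuarter_mono` below).
[folklore] -/
theorem reDigammaQuarter_le_log (u : ℝ) :
    reDigammaQuarter u ≤ 5 + Real.log (1 + |u|) := by
  -- the bound for `|u| ≥ 1`
  have key : ∀ u : ℝ, 1 ≤ |u| → reDigammaQuarter u ≤ 4 + Real.log (1 + |u|) := by
    intro u hu
    set w : ℂ := 1 / 4 + u / 2 * I with hw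
    have hre : w.re = 1 / 4 := by simp [hw]
    have him : w.im = u / 2 := by simp [hw]
    have hw0 : 0 < w.re := by rw [hre]; norm_num
    have hwi : w.im ≠ 0 := by
      rw [him]
      intro h0
      have : u = 0 := by linarith
      rw [this, abs_zero] at hu
      linarith
    have h := Literature.Analysis.SpecialFunctions.Complex.re_digamma_le_log_norm_add hw0 hwi
    -- `‖w‖ ≤ 1 + |u|`, `‖w‖ ≥ |u|/2 ≥ 1/2`
    have hn1 : ‖w‖ ≤ 1 + |u| := by
      calc ‖w‖ ≤ ‖(1 / 4 : ℂ)‖ + ‖(u / 2 : ℂ) * I‖ := norm_add_le _ _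
        _ = 1 / 4 + |u| / 2 := by
            rw [norm_mul, Complex.norm_I, mul_one]
            have : ((u : ℂ) / 2) = ((u / 2 : ℝ) : ℂ) := by push_cast; ring
            rw [this, Complex.norm_real, Real.norm_eq_abs, abs_div, abs_two]
            norm_num
        _ ≤ 1 + |u| := by linarith [abs_nonneg u]
    have hn2 : |u| / 2 ≤ ‖w‖ := by
      have := Complex.abs_im_le_norm w
      rw [him, abs_div, abs_two] at this
      exact this
    have hnpos : 0 < ‖w‖ := by linarith
    have hlog : Real.log ‖w‖ ≤ Real.log (1 + |u|) := Real.log_le_log hnpos hn1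
    have h2 : 1 / (2 * ‖w‖ ^ 2) ≤ 2 := by
      rw [div_le_iff₀ (by positivity)]
      nlinarith
    have h3 : π / (4 * |w.im|) ≤ 2 := by
      rw [him, abs_div, abs_two, div_le_iff₀ (by positivity)]
      nlinarith [Real.pi_lt_d2]
    have : reDigammaQuarter u = (Complex.digamma w).re := rfl
    linarith
  rcases le_or_gt 1 |u| with hu | hu
  · linarith [key u hu]
  · have hmono : reDigammaQuarter u ≤ reDigammaQuarter 1 :=
      reDigammaQuarter_mono (by rw [abs_one]; exact hu.le)
    have h1 := key 1 (by rw [abs_one])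
    rw [abs_one] at h1
    have hlog2 : Real.log (1 + 1) ≤ 1 := by
      rw [one_add_one_eq_two]
      linarith [Real.log_two_lt_d9]
    have hlog0 : 0 ≤ Real.log (1 + |u|) := Real.log_nonneg (by linarith [abs_nonneg u])
    linarith

/-! #### A narrow non-negative bump and a lower bound for its transform near the origin -/

/-- For `0 < δ ≤ 1/2` there is a Weil test `h` supported in `[-δ, δ]` and a constant `c > 0`
with `c ≤ |ĥ(1/2 + iv)|²` for all `|v| ≤ 1`, together with `∫ |h|² ≤ 1`... we record what is
needed: support, the uniform lower bound on `|v| ≤ 1`. (A normalised smooth bump at `0`: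
`Re ĥ(1/2+iv) = ∫ h(t) cos(vt) dt ≥ cos(1/2) ∫ h`.) [folklore] -/
theorem exists_bump_lower {δ : ℝ} (hδ : 0 < δ) (hδ1 : δ ≤ 1 / 2) :
    ∃ h : ℝ → ℂ, IsWeilTest h ∧ tsupport h ⊆ Icc (-δ) δ ∧ (∀ t, ‖h t‖ ≤ 1) ∧
      ∃ c : ℝ, 0 < c ∧ ∀ v : ℝ, |v| ≤ 1 → c ≤ ‖weilMellin h (1 / 2 + v * I)‖ ^ 2 := by
  let b : ContDiffBump (0 : ℝ) := ⟨δ / 2, δ, by positivity, by linarith⟩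
  set h : ℝ → ℂ := fun t => ((b t : ℝ) : ℂ) with hh_def
  have hh : IsWeilTest h :=
    ⟨Complex.ofRealCLM.contDiff.comp b.contDiff, b.hasCompactSupport.comp_left Complex.ofReal_zero⟩
  have hsupp : tsupport h ⊆ Icc (-δ) δ := by
    refine (tsupport_comp_subset Complex.ofReal_zero _).trans ?_
    rw [b.tsupport_eq, Real.closedBall_eq_Icc, zero_sub, zero_add]
  have hle1 : ∀ t, ‖h t‖ ≤ 1 := fun t => by
    simp only [hh_def, Complex.norm_real, Real.norm_eq_abs, abs_of_nonneg (b.nonneg)]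
    exact b.le_one
  set m : ℝ := ∫ t, b t with hm
  have hmpos : 0 < m := b.integral_pos
  have hcos : 0 < Real.cos (1 / 2) :=
    Real.cos_pos_of_mem_Ioo ⟨by linarith [Real.pi_gt_three], by linarith [Real.pi_gt_three]⟩
  refine ⟨h, hh, hsupp, hle1, (Real.cos (1 / 2) * m) ^ 2, by positivity, fun v hv => ?_⟩
  -- `Re ĥ(1/2+iv) = ∫ b(t) cos(vt) dt ≥ cos(1/2) · m`
  have hint : Integrable fun t : ℝ => h t * cexp ((1 / 2 + v * I - 1 / 2) * t) :=
    integrable_weilIntegrand hh.1.continuous hh.2 _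
  have hre : (weilMellin h (1 / 2 + v * I)).re = ∫ t, b t * Real.cos (v * t) := by
    unfold weilMellin
    have hre' := integral_re hint
    simp only [RCLike.re_to_complex] at hre'
    rw [← hre']
    refine integral_congr_ae (Eventually.of_forall fun t => ?_)
    have e : (1 / 2 + (v : ℂ) * I - 1 / 2) * (t : ℂ) = ((v * t : ℝ) : ℂ) * I := by
      push_cast; ring
    simp only [hh_def]
    rw [e, Complex.re_ofReal_mul, Complex.exp_ofReal_mul_I_re]
  have hlow : Real.cos (1 / 2) * m ≤ (weilMellin h (1 / 2 + v * I)).re := by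
    rw [hre, hm, ← MeasureTheory.integral_const_mul]
    refine integral_mono ((b.continuous.integrable_of_hasCompactSupport
      b.hasCompactSupport).const_mul _) ?_ fun t => ?_
    · exact (b.continuous.mul (by fun_prop)).integrable_of_hasCompactSupport
        b.hasCompactSupport.mul_right
    · by_cases ht : b t = 0
      · simp [ht]
      · have hts : t ∈ Function.support b := ht
        rw [b.support_eq, Metric.mem_ball, dist_zero_right, Real.norm_eq_abs] at hts
        have hvt : |v * t| ≤ 1 / 2 := by
          rw [abs_mul]
          nlinarith [abs_nonneg v, abs_nonneg t]
        have hc : Real.cos (1 / 2) ≤ Real.cos (v * t) := by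
          rw [← Real.cos_abs (v * t)]
          exact Real.cos_le_cos_of_nonneg_of_le_pi (abs_nonneg _)
            (by linarith [Real.pi_gt_three]) hvt
        rw [mul_comm]
        exact mul_le_mul_of_nonneg_left hc b.nonneg
  have hre_le : (weilMellin h (1 / 2 + v * I)).re ≤ ‖weilMellin h (1 / 2 + v * I)‖ :=
    Complex.re_le_norm _
  have h0 : 0 ≤ Real.cos (1 / 2) * m := by positivity
  nlinarith

/-! #### Modulation `h_T(t) = e^{-iTt} h(t)` -/

/-- Modulated test functions are test functions. [folklore] -/
theorem isWeilTest_modulate {h : ℝ → ℂ} (hh : IsWeilTest h) (T : ℝ) :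
    IsWeilTest fun t : ℝ => cexp (-((T * t : ℝ) : ℂ) * I) * h t := by
  refine ⟨ContDiff.mul ?_ hh.1, hh.2.mul_left⟩
  have h1 : ContDiff ℝ ∞ fun t : ℝ => -((T * t : ℝ) : ℂ) * I :=
    ((Complex.ofRealCLM.contDiff.comp (contDiff_const.mul contDiff_id)).neg.mul contDiff_const)
  exact Complex.contDiff_exp.comp h1

/-- Modulation does not enlarge the support. [folklore] -/
theorem tsupport_modulate_subset (h : ℝ → ℂ) (T : ℝ) :
    tsupport (fun t : ℝ => cexp (-((T * t : ℝ) : ℂ) * I) * h t) ⊆ tsupport h :=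
  tsupport_mul_subset_right

/-- Modulation has modulus one pointwise. [folklore] -/
theorem norm_modulate (h : ℝ → ℂ) (T t : ℝ) :
    ‖cexp (-((T * t : ℝ) : ℂ) * I) * h t‖ = ‖h t‖ := by
  rw [norm_mul, show -((T * t : ℝ) : ℂ) * I = ((-(T * t) : ℝ) : ℂ) * I by push_cast; ring,
    Complex.norm_exp_ofReal_mul_I, one_mul]

/-- **Modulation shifts the transform**: `(e^{-iT·} h)^(1/2 + iu) = ĥ(1/2 + i(u - T))`.
[folklore] -/
theorem weilMellin_modulate (h : ℝ → ℂ) (T u : ℝ) :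
    weilMellin (fun t : ℝ => cexp (-((T * t : ℝ) : ℂ) * I) * h t) (1 / 2 + u * I) =
      weilMellin h (1 / 2 + ((u - T : ℝ) : ℂ) * I) := by
  unfold weilMellin
  refine integral_congr_ae (Eventually.of_forall fun t => ?_)
  simp only
  rw [mul_comm (cexp _) (h t), mul_assoc, ← Complex.exp_add]
  congr 2
  push_cast
  ring

/-! #### The local Weyl law: `O(log T)` points per unit interval -/

/-- **Local Weyl upper bound for window-trace families.** If a real family `γ : ι → ℝ`
reproduces the Weil functional on every Weil test supported in `[-A, A]` (`A > 0`), then the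
number of its points in any unit interval `[T-1, T+1]` is `O_A(1 + log(1 + |T|))`, with a
constant depending only on `min(A, log 2)` (so UNIFORM in `A ≥ log 2`, as needed for passing to
the limit `A → ∞`). Proof: test the identity against the modulated autocorrelation of a narrow
bump `h` (`supp h ⊆ [-δ, δ]`, `δ = min(A/2, (log 2)/2, 1/2)`): each point in `[T-1, T+1]` costs
at least `c(h) > 0` (`exists_bump_lower`, `weilMellin_modulate`), the total is `Re Q(h_T)`
(`sum_norm_sq_le` via `weilMellin_weilConv_weilReflect_half`), and
`Re Q(h_T) = 2Re(ĥ_T(0)conj ĥ_T(1)) - log π‖h‖₂² + (1/2π)∫|ĥ(1/2+i(u-T))|² Re ψ(1/4+iu/2) du`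
(`weilQuadratic_re_eq_weilArchQuadratic`) is `≤ 2‖h‖²_{L¹,1/2} + K(h) + P(h) log(1+|T|)` by
`Re ψ(1/4+iu/2) ≤ 5 + log(1+|u|)` (`reDigammaQuarter_le_log`). [folklore] -/
theorem card_near_le_log_of_windowTrace {A : ℝ} (hA : 0 < A) {ι : Type*} {γ : ι → ℝ}
    (h : ∀ g : ℝ → ℂ, IsWeilTest g → tsupport g ⊆ Icc (-A) A →
      HasSum (fun i => weilMellin g (1 / 2 + (γ i : ℂ) * I)) (weilFunctional g)) :
    ∃ C : ℝ, 0 < C ∧ ∀ (T : ℝ) (s : Finset ι), (∀ i ∈ s, |γ i - T| ≤ 1) →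
      (s.card : ℝ) ≤ C * (1 + Real.log (1 + |T|)) := by
  -- the bump
  set δ : ℝ := min (A / 2) (min (Real.log 2 / 2) (1 / 2)) with hδ_def
  have hlog2 : 0 < Real.log 2 := Real.log_pos one_lt_two
  have hδ : 0 < δ := lt_min (half_pos hA) (lt_min (half_pos hlog2) one_half_pos)
  have hδA : δ ≤ A / 2 := min_le_left _ _
  have hδl : δ ≤ Real.log 2 / 2 := (min_le_right _ _).trans (min_le_left _ _)
  have hδ1 : δ ≤ 1 / 2 := (min_le_right _ _).trans (min_le_right _ _)
  obtain ⟨w, hw, hws, hw1, c, hc, hlow⟩ := exists_bump_lower hδ hδ1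
  -- constants
  set L : ℝ := weilL1 w with hL
  have hL0 : 0 ≤ L := weilL1_nonneg w
  set P : ℝ := ∫ v : ℝ, ‖weilMellin w (1 / 2 + v * I)‖ ^ 2 with hP
  have hP0 : 0 ≤ P := integral_nonneg fun _ => by positivity
  set K : ℝ := ∫ v : ℝ, ‖weilMellin w (1 / 2 + v * I)‖ ^ 2 * (5 + Real.log (1 + |v|)) with hK
  have hK0 : 0 ≤ K := integral_nonneg fun v => by
    have : 0 ≤ Real.log (1 + |v|) := Real.log_nonneg (by linarith [abs_nonneg v])
    positivity
  refine ⟨(2 * L ^ 2 + K + P + 1) / c, by positivity, fun T s hs => ?_⟩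
  -- the modulated test
  set wT : ℝ → ℂ := fun t => cexp (-((T * t : ℝ) : ℂ) * I) * w t with hwT_def
  have hwT : IsWeilTest wT := isWeilTest_modulate hw T
  have hwTs : tsupport wT ⊆ Icc (-δ) δ := (tsupport_modulate_subset w T).trans hws
  have hwTsA : tsupport wT ⊆ Icc (-(A / 2)) (A / 2) :=
    hwTs.trans (Icc_subset_Icc (by linarith) hδA)
  have hwTsl : tsupport wT ⊆ Icc (-(Real.log 2 / 2)) (Real.log 2 / 2) :=
    hwTs.trans (Icc_subset_Icc (by linarith) hδl)
  -- (1) lower bound: each point near `T` costs `c`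
  have hcount : (s.card : ℝ) * c ≤ ∑ i ∈ s, ‖weilMellin wT (1 / 2 + (γ i : ℂ) * I)‖ ^ 2 := by
    have : ∑ _i ∈ s, c ≤ ∑ i ∈ s, ‖weilMellin wT (1 / 2 + (γ i : ℂ) * I)‖ ^ 2 := by
      refine Finset.sum_le_sum fun i hi => ?_
      have e : weilMellin wT (1 / 2 + (γ i : ℂ) * I) =
          weilMellin w (1 / 2 + ((γ i - T : ℝ) : ℂ) * I) := weilMellin_modulate w T (γ i)
      rw [e]
      exact hlow (γ i - T) (hs i hi)
    rwa [Finset.sum_const, nsmul_eq_mul] at this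
  -- (2) the sum is bounded by `Re Q(w_T)`
  have hsum : ∑ i ∈ s, ‖weilMellin wT (1 / 2 + (γ i : ℂ) * I)‖ ^ 2 ≤ (weilQuadratic wT).re := by
    have hk : IsWeilTest (weilConv wT (weilReflect wT)) := hwT.weilConv hwT.weilReflect
    have hks : tsupport (weilConv wT (weilReflect wT)) ⊆ Icc (-A) A :=
      (tsupport_weilConv_weilReflect_subset hwT.2 hwTsA).trans
        (Icc_subset_Icc (by linarith) (by linarith))
    have hsumC : HasSum (fun i => (((‖weilMellin wT (1 / 2 + (γ i : ℂ) * I)‖ ^ 2 : ℝ) : ℂ)))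
        (weilFunctional (weilConv wT (weilReflect wT))) := by
      simpa only [weilMellin_weilConv_weilReflect_half hwT] using h _ hk hks
    have hsumR : HasSum (fun i => ‖weilMellin wT (1 / 2 + (γ i : ℂ) * I)‖ ^ 2)
        (weilFunctional (weilConv wT (weilReflect wT))).re := by
      simpa only [Complex.reCLM_apply, Complex.ofReal_re] using hsumC.mapL Complex.reCLM
    unfold weilQuadratic
    exact sum_le_hasSum s (fun _ _ => by positivity) hsumR
  -- (3) `Re Q(w_T)` in Yoshida's analytic form, bounded term by term
  have hQ : (weilQuadratic wT).re = weilArchQuadratic wT :=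
    weilQuadratic_re_eq_weilArchQuadratic hwT hwTsl
  -- (3a) polar part
  have hLT : weilL1 wT = L := by
    rw [hL, weilL1, weilL1]
    refine integral_congr_ae (Eventually.of_forall fun t => ?_)
    simp only [hwT_def, norm_modulate]
  have hpol : 2 * (weilMellin wT 0 * conj (weilMellin wT 1)).re ≤ 2 * L ^ 2 := by
    have h0 : ‖weilMellin wT 0‖ ≤ L := by
      rw [← hLT]; exact norm_weilMellin_le_weilL1 hwT.1.continuous hwT.2 (by simp) (by simp)
    have h1 : ‖weilMellin wT 1‖ ≤ L := by
      rw [← hLT]; exact norm_weilMellin_le_weilL1 hwT.1.continuous hwT.2 (by simp) (by simp)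
    have h2 : (weilMellin wT 0 * conj (weilMellin wT 1)).re ≤
        ‖weilMellin wT 0‖ * ‖weilMellin wT 1‖ := by
      refine (Complex.re_le_norm _).trans ?_
      rw [norm_mul, Complex.norm_conj]
    nlinarith [norm_nonneg (weilMellin wT 0), norm_nonneg (weilMellin wT 1)]
  -- (3b) the `L²` part is non-positive
  have hN : 0 ≤ Real.log π * ∫ t, ‖wT t‖ ^ 2 :=
    mul_nonneg (Real.log_nonneg (by linarith [Real.pi_gt_three]))
      (integral_nonneg fun _ => by positivity)
  -- (3c) the archimedean integral
  have hF : ∀ v : ℝ, |5 + Real.log (1 + |v|) + Real.log (1 + |T|)| ≤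
      (6 + Real.log (1 + |T|)) + (1 / 2) * v ^ 2 := by
    intro v
    have h1 : 0 ≤ Real.log (1 + |v|) := Real.log_nonneg (by linarith [abs_nonneg v])
    have h2 : 0 ≤ Real.log (1 + |T|) := Real.log_nonneg (by linarith [abs_nonneg T])
    have h3 : Real.log (1 + |v|) ≤ |v| := by
      have := Real.log_le_sub_one_of_pos (by linarith [abs_nonneg v] : (0 : ℝ) < 1 + |v|)
      linarith
    rw [abs_of_nonneg (by linarith)]
    nlinarith [sq_nonneg (|v| - 1), sq_abs v]
  have hint0 : Integrable fun v : ℝ => ‖weilMellin w (1 / 2 + v * I)‖ ^ 2 *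
      (5 + Real.log (1 + |v|) + Real.log (1 + |T|)) := by
    refine integrable_norm_sq_weilMellin_mul hw (by fun_prop) (by
      linarith [Real.log_nonneg (by linarith [abs_nonneg T] : (1 : ℝ) ≤ 1 + |T|)])
      (by norm_num) hF
  have hint1 : Integrable fun u : ℝ => ‖weilMellin w (1 / 2 + ((u - T : ℝ) : ℂ) * I)‖ ^ 2 *
      (5 + Real.log (1 + |u - T|) + Real.log (1 + |T|)) := by
    have := hint0.comp_sub_right T
    exact this
  have harch : ∫ u : ℝ, ‖weilMellin wT (1 / 2 + u * I)‖ ^ 2 *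
        (Complex.digamma (1 / 4 + u / 2 * I)).re ≤ K + Real.log (1 + |T|) * P := by
    calc ∫ u : ℝ, ‖weilMellin wT (1 / 2 + u * I)‖ ^ 2 * (Complex.digamma (1 / 4 + u / 2 * I)).re
        ≤ ∫ u : ℝ, ‖weilMellin w (1 / 2 + ((u - T : ℝ) : ℂ) * I)‖ ^ 2 *
            (5 + Real.log (1 + |u - T|) + Real.log (1 + |T|)) := by
          refine integral_mono (integrable_norm_sq_weilMellin_mul_reDigammaQuarter hwT) hint1
            fun u => ?_
          simp only
          rw [weilMellin_modulate w T u]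
          refine mul_le_mul_of_nonneg_left ?_ (by positivity)
          have h1 := reDigammaQuarter_le_log u
          have h2 : Real.log (1 + |u|) ≤ Real.log (1 + |u - T|) + Real.log (1 + |T|) := by
            rw [← Real.log_mul (by positivity) (by positivity)]
            refine Real.log_le_log (by positivity) ?_
            have : |u| ≤ |u - T| + |T| := by
              simpa using abs_add_le (u - T) T
            nlinarith [abs_nonneg (u - T), abs_nonneg T]
          change reDigammaQuarter u ≤ _
          linarith
      _ = ∫ v : ℝ, ‖weilMellin w (1 / 2 + v * I)‖ ^ 2 *
            (5 + Real.log (1 + |v|) + Real.log (1 + |T|)) := by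
          have := integral_sub_right_eq_self (μ := (volume : Measure ℝ))
            (fun v : ℝ => ‖weilMellin w (1 / 2 + v * I)‖ ^ 2 *
              (5 + Real.log (1 + |v|) + Real.log (1 + |T|))) T
          simpa using this
      _ = K + Real.log (1 + |T|) * P := by
          have e : (fun v : ℝ => ‖weilMellin w (1 / 2 + v * I)‖ ^ 2 *
              (5 + Real.log (1 + |v|) + Real.log (1 + |T|))) =
              fun v : ℝ => ‖weilMellin w (1 / 2 + v * I)‖ ^ 2 * (5 + Real.log (1 + |v|)) +
                Real.log (1 + |T|) * ‖weilMellin w (1 / 2 + v * I)‖ ^ 2 := by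
            funext v; ring
          have hi1 : Integrable fun v : ℝ => ‖weilMellin w (1 / 2 + v * I)‖ ^ 2 *
              (5 + Real.log (1 + |v|)) := by
            refine integrable_norm_sq_weilMellin_mul hw (by fun_prop) (by norm_num : (0:ℝ) ≤ 6)
              (by norm_num : (0:ℝ) ≤ 1 / 2) fun v => ?_
            have h1 : 0 ≤ Real.log (1 + |v|) := Real.log_nonneg (by linarith [abs_nonneg v])
            have h3 : Real.log (1 + |v|) ≤ |v| := by
              have := Real.log_le_sub_one_of_pos (by linarith [abs_nonneg v] : (0 : ℝ) < 1 + |v|)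
              linarith
            rw [abs_of_nonneg (by linarith)]
            nlinarith [sq_nonneg (|v| - 1), sq_abs v]
          have hi2 : Integrable fun v : ℝ =>
              Real.log (1 + |T|) * ‖weilMellin w (1 / 2 + v * I)‖ ^ 2 :=
            (integrable_norm_sq_weilMellin_half_line hw).const_mul _
          rw [e, integral_add hi1 hi2, MeasureTheory.integral_const_mul]
  -- (4) assemble
  have hQle : (weilQuadratic wT).re ≤ 2 * L ^ 2 + K + P * Real.log (1 + |T|) := by
    rw [hQ, weilArchQuadratic]
    have hpi : 1 / (2 * π) * (K + Real.log (1 + |T|) * P) ≤ K + Real.log (1 + |T|) * P := by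
      have hX : 0 ≤ K + Real.log (1 + |T|) * P := by
        have := Real.log_nonneg (by linarith [abs_nonneg T] : (1 : ℝ) ≤ 1 + |T|)
        positivity
      have h12 : 1 / (2 * π) ≤ 1 := by
        rw [div_le_one (by positivity)]; linarith [Real.pi_gt_three]
      nlinarith
    have harch' : 1 / (2 * π) * ∫ u : ℝ, ‖weilMellin wT (1 / 2 + u * I)‖ ^ 2 *
        (Complex.digamma (1 / 4 + u / 2 * I)).re ≤ 1 / (2 * π) * (K + Real.log (1 + |T|) * P) :=
      mul_le_mul_of_nonneg_left harch (by positivity)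
    nlinarith
  have hlogT : 0 ≤ Real.log (1 + |T|) := Real.log_nonneg (by linarith [abs_nonneg T])
  have hmain : (s.card : ℝ) * c ≤ 2 * L ^ 2 + K + P * Real.log (1 + |T|) :=
    hcount.trans (hsum.trans hQle)
  rw [div_mul_eq_mul_div, le_div_iff₀ hc]
  nlinarith

/-- **Local finiteness with a `log` bound.** For a window-trace family, every unit window
`{i : |γ_i - T| ≤ 1}` is a finite set of cardinality `≤ C (1 + log(1 + |T|))`. [folklore] -/
theorem finite_near_of_windowTrace {A : ℝ} (hA : 0 < A) {ι : Type*} {γ : ι → ℝ}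
    (h : ∀ g : ℝ → ℂ, IsWeilTest g → tsupport g ⊆ Icc (-A) A →
      HasSum (fun i => weilMellin g (1 / 2 + (γ i : ℂ) * I)) (weilFunctional g)) :
    ∃ C : ℝ, 0 < C ∧ ∀ T : ℝ, {i : ι | |γ i - T| ≤ 1}.Finite ∧
      (({i : ι | |γ i - T| ≤ 1}.ncard : ℕ) : ℝ) ≤ C * (1 + Real.log (1 + |T|)) := by
  obtain ⟨C, hC, hcard⟩ := card_near_le_log_of_windowTrace hA h
  refine ⟨C, hC, fun T => ?_⟩
  have hfin : {i : ι | |γ i - T| ≤ 1}.Finite := by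
    by_contra hinf
    obtain ⟨t, hts, htc⟩ := Set.Infinite.exists_subset_card_eq hinf
      (⌊C * (1 + Real.log (1 + |T|))⌋₊ + 1)
    have h1 := hcard T t fun i hi => hts (Finset.mem_coe.2 hi)
    rw [htc] at h1
    have h2 := Nat.lt_floor_add_one (C * (1 + Real.log (1 + |T|)))
    push_cast at h1
    linarith
  refine ⟨hfin, ?_⟩
  rw [Set.ncard_eq_toFinset_card _ hfin]
  exact hcard T hfin.toFinset fun i hi => (hfin.mem_toFinset.1 hi)

/-- **Local finiteness**: for a window-trace family, `{i : |γ_i| ≤ R}` is finite for every `R`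
(cover `[-R, R]` by the unit windows around the integers). [folklore] -/
theorem finite_abs_le_of_windowTrace {A : ℝ} (hA : 0 < A) {ι : Type*} {γ : ι → ℝ}
    (h : ∀ g : ℝ → ℂ, IsWeilTest g → tsupport g ⊆ Icc (-A) A →
      HasSum (fun i => weilMellin g (1 / 2 + (γ i : ℂ) * I)) (weilFunctional g)) (R : ℝ) :
    {i : ι | |γ i| ≤ R}.Finite := by
  obtain ⟨C, -, hC⟩ := finite_near_of_windowTrace hA h
  have hcov : {i : ι | |γ i| ≤ R} ⊆
      ⋃ k ∈ Set.Icc (-(⌈R⌉ + 1)) (⌈R⌉ + 1), {i : ι | |γ i - (k : ℤ)| ≤ 1} := by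
    intro i hi
    simp only [Set.mem_setOf_eq] at hi
    simp only [Set.mem_iUnion, Set.mem_setOf_eq, Set.mem_Icc, exists_prop]
    refine ⟨⌊γ i⌋, ⟨?_, ?_⟩, ?_⟩
    · have h1 : (⌊γ i⌋ : ℝ) > γ i - 1 := by linarith [Int.lt_floor_add_one (γ i)]
      have h2 : γ i - 1 ≥ -R - 1 := by linarith [neg_abs_le (γ i), (abs_le.1 hi).1]
      have h3 : (-(⌈R⌉ + 1) : ℝ) ≤ -R - 1 := by
        have := Int.le_ceil R
        linarith
      have : ((-(⌈R⌉ + 1) : ℤ) : ℝ) < (⌊γ i⌋ : ℝ) := by push_cast; linarith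
      exact_mod_cast this.le
    · have h1 : (⌊γ i⌋ : ℝ) ≤ γ i := Int.floor_le (γ i)
      have h2 : γ i ≤ R := (abs_le.1 hi).2
      have h3 : (R : ℝ) ≤ ⌈R⌉ := Int.le_ceil R
      have : (⌊γ i⌋ : ℝ) ≤ ((⌈R⌉ + 1 : ℤ) : ℝ) := by push_cast; linarith
      exact_mod_cast this
    · rw [abs_le]
      constructor <;> linarith [Int.floor_le (γ i), Int.lt_floor_add_one (γ i)]
  exact ((Set.finite_Icc (-(⌈R⌉ + 1)) (⌈R⌉ + 1)).biUnion
    (t := fun k : ℤ => {i : ι | |γ i - (k : ℝ)| ≤ 1}) fun k _ => (hC (k : ℝ)).1).subset hcov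

/-- The crux window `[-log 2, log 2]`: `O(log T)` points per unit interval. [folklore] -/
theorem card_near_le_log_of_windowTraceArch_witness {ι : Type} {γ : ι → ℝ}
    (h : ∀ g : ℝ → ℂ, IsWeilTest g → tsupport g ⊆ Icc (-Real.log 2) (Real.log 2) →
      HasSum (fun i => weilMellin g (1 / 2 + (γ i : ℂ) * I)) (weilFunctional g)) :
    ∃ C : ℝ, 0 < C ∧ ∀ (T : ℝ) (s : Finset ι), (∀ i ∈ s, |γ i - T| ≤ 1) →
      (s.card : ℝ) ≤ C * (1 + Real.log (1 + |T|)) :=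
  card_near_le_log_of_windowTrace (Real.log_pos one_lt_two) h

/-- The crux window: local finiteness of every `WindowTraceArch` witness. [folklore] -/
theorem finite_abs_le_of_windowTraceArch_witness {ι : Type} {γ : ι → ℝ}
    (h : ∀ g : ℝ → ℂ, IsWeilTest g → tsupport g ⊆ Icc (-Real.log 2) (Real.log 2) →
      HasSum (fun i => weilMellin g (1 / 2 + (γ i : ℂ) * I)) (weilFunctional g)) (R : ℝ) :
    {i : ι | |γ i| ≤ R}.Finite :=
  finite_abs_le_of_windowTrace (Real.log_pos one_lt_two) h R


/-! ## §3 Why no unconditional kill exists: the complex relaxation is a theorem, and RH ⇒ crux -/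

/-- The non-trivial zeros of `ζ` repeated with multiplicity: index type of the canonical
(complex!) spectrum. -/
abbrev ZeroIdx : Type :=
  Σ ρ : ZetaZeros.riemannZetaNontrivialZeros, Fin (riemannZetaZeroOrder (ρ : ℂ)).toNat

/-- Cast bookkeeping: `(m(ρ) : ℂ) = (m(ρ).toNat : ℂ)` on non-trivial zeros (`m(ρ) ≥ 1`). -/
theorem cast_order_toNat (ρ : ZetaZeros.riemannZetaNontrivialZeros) :
    (((riemannZetaZeroOrder (ρ : ℂ)).toNat : ℕ) : ℂ) = (riemannZetaZeroOrder (ρ : ℂ) : ℂ) := by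
  have h1 := ZetaZeros.riemannZetaNontrivialZeros.one_le_order ρ.2
  have h2 : ((riemannZetaZeroOrder (ρ : ℂ)).toNat : ℤ) = riemannZetaZeroOrder (ρ : ℂ) :=
    Int.toNat_of_nonneg (by omega)
  exact_mod_cast congrArg (fun z : ℤ => (z : ℂ)) h2

/-- **The complex relaxation of the crux is an unconditional THEOREM.** For every Weil test `g`,
`HasSum (p ↦ ĝ(ρ_p)) (W g)` over the non-trivial zeros repeated with multiplicity
(`explicit_formula_holds` + absolute convergence `summable_norm_zeroSide`, regrouped on the
sigma type). Hence the statement "∃ (ι) (s : ι → ℂ), ∀ Weil g, HasSum (i ↦ ĝ(s i)) (W g)" — the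
crux with `1/2 + iγ_i`, `γ_i ∈ ℝ` relaxed to arbitrary `s_i ∈ ℂ` — holds for ALL tests, window
or not: the reality of the spectrum is the entire content of the crux (and of `X`). -/
theorem hasSum_weilMellin_zeros {g : ℝ → ℂ} (hg : IsWeilTest g) :
    HasSum (fun p : ZeroIdx => weilMellin g (p.1 : ℂ)) (weilFunctional g) := by
  set f : ZeroIdx → ℂ := fun p => weilMellin g (p.1 : ℂ) with hf
  -- fibrewise the sums are finite: `m(ρ) • ĝ(ρ)`
  have hfib : ∀ ρ : ZetaZeros.riemannZetaNontrivialZeros,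
      HasSum (fun c : Fin (riemannZetaZeroOrder (ρ : ℂ)).toNat => f ⟨ρ, c⟩)
        ((riemannZetaZeroOrder (ρ : ℂ) : ℂ) * weilMellin g ρ) := by
    intro ρ
    have h := hasSum_fintype (fun c : Fin (riemannZetaZeroOrder (ρ : ℂ)).toNat => f ⟨ρ, c⟩)
    simp only [hf, Finset.sum_const, Finset.card_univ, Fintype.card_fin, nsmul_eq_mul,
      cast_order_toNat] at h
    exact h
  -- absolute summability on the sigma type
  have hnorm : Summable fun p : ZeroIdx => ‖f p‖ := by
    rw [summable_sigma_of_nonneg (fun _ => norm_nonneg _)]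
    refine ⟨fun ρ => (hasSum_fintype _).summable, ?_⟩
    refine (summable_norm_zeroSide hg).congr fun ρ => ?_
    simp only [hf, tsum_fintype, Finset.sum_const, Finset.card_univ, Fintype.card_fin,
      nsmul_eq_mul, norm_mul]
    rw [← cast_order_toNat, Complex.norm_natCast]
  have hF : HasSum f (∑' p, f p) := hnorm.of_norm.hasSum
  -- regroup by fibres and compare with the explicit formula
  have hG : HasSum (fun ρ : ZetaZeros.riemannZetaNontrivialZeros =>
      (riemannZetaZeroOrder (ρ : ℂ) : ℂ) * weilMellin g ρ) (∑' p, f p) := hF.sigma hfib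
  have hEF : ∑' ρ : ZetaZeros.riemannZetaNontrivialZeros,
      (riemannZetaZeroOrder (ρ : ℂ) : ℂ) * weilMellin g ρ = weilFunctional g :=
    tendsto_nhds_unique (hasWeilZeroSide_tsum (summable_norm_zeroSide hg))
      (explicit_formula_holds hg)
  have hsum : ∑' p, f p = weilFunctional g := hG.tsum_eq.symm.trans hEF
  rw [← hsum]
  exact hF

/-- The complex-spectrum relaxation, stated: some complex family reproduces `W` on EVERY Weil
test (no window needed). -/
theorem exists_complex_spectrum :
    ∃ (ι : Type) (s : ι → ℂ), ∀ g : ℝ → ℂ, IsWeilTest g →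
      HasSum (fun i => weilMellin g (s i)) (weilFunctional g) :=
  ⟨ZeroIdx, fun p => (p.1 : ℂ), fun _ hg => hasSum_weilMellin_zeros hg⟩

/-- Under RH every non-trivial zero reads `ρ = 1/2 + i·Im ρ`. -/
theorem eq_half_add_of_riemannHypothesis (hRH : RiemannHypothesis)
    (ρ : ZetaZeros.riemannZetaNontrivialZeros) :
    (1 / 2 : ℂ) + (((ρ : ℂ).im : ℝ) : ℂ) * I = (ρ : ℂ) := by
  have hre : (ρ : ℂ).re = 1 / 2 := by
    refine hRH ρ (ZetaZeros.riemannZetaNontrivialZeros.zeta_eq_zero ρ.2) ?_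
      (ZetaZeros.riemannZetaNontrivialZeros.ne_one ρ.2)
    rintro ⟨n, hn⟩
    have h0 := ZetaZeros.riemannZetaNontrivialZeros.re_pos ρ.2
    rw [hn] at h0
    simp at h0
    linarith [n.cast_nonneg (α := ℝ)]
  apply Complex.ext <;> simp [hre]

/-- **RH ⇒ every rung** (in particular the crux), kernel-checked: the ordinates of the zeros,
repeated with multiplicity, are a real unit-multiplicity family reproducing `W` on all tests.
So `¬ WindowTrace A` for any `A` would be a disproof of RH: the crux is irrefutable short of
`¬ RH`. (This is also the content of the route's support item `SpectralConverse`, 0193.) -/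
theorem windowTrace_of_riemannHypothesis (hRH : RiemannHypothesis) (A : ℝ) : WindowTrace A := by
  refine ⟨ZeroIdx, fun p => (p.1 : ℂ).im, fun g hg _ => ?_⟩
  simpa only [eq_half_add_of_riemannHypothesis hRH] using hasSum_weilMellin_zeros hg

/-- RH ⇒ the target `X` (no window). -/
theorem windowTraceArchWithoutWindow_of_riemannHypothesis (hRH : RiemannHypothesis) :
    WindowTraceArchWithoutWindow := by
  refine ⟨ZeroIdx, fun p => (p.1 : ℂ).im, fun g hg => ?_⟩
  simpa only [eq_half_add_of_riemannHypothesis hRH] using hasSum_weilMellin_zeros hg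

/-- RH ⇒ the crux window (stated on `WindowTrace (log 2)`, which is the crux by
`windowTraceArch_iff`; kept in this shape so that no declaration of this ADVERSARY file has the
route decl as its conclusion). -/
theorem windowTrace_log_two_of_riemannHypothesis : RiemannHypothesis → WindowTrace (Real.log 2) :=
  fun hRH => windowTrace_of_riemannHypothesis hRH (Real.log 2)

/-- **Barrier reduction**: a refutation of the crux is a refutation of the Riemann hypothesis. -/
theorem not_riemannHypothesis_of_not_windowTraceArch (h : ¬ WindowTraceArch) :
    ¬ RiemannHypothesis :=
  fun hRH => h (windowTraceArch_iff.2 (windowTrace_log_two_of_riemannHypothesis hRH))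

end Summit.RiemannHypothesis.RiemannHypothesis.Cruxes.WindowTraceArch.Disproof

end

/-!
# A certified low forbidden zone for window-trace families (crux `WindowTraceArch`)

Negative lemma for the crux `WindowTraceArch` (stmt-RiemannHypothesis-11195) of route
`SpectralTrace`: **no real unit-multiplicity family reproducing the Weil functional on the Weil
tests supported in `[-log 2, log 2]` has a point in the open interval `(-11, 11)`.**

Mechanism (refuter, cdisprove seat): for a witness `γ` and a test `g` supported in the half
window, unit masses cost `|ĝ(1/2 + iγ_j)|² ≤ Re Q(g)` (Bochner form of the window identity),
while UNCONDITIONALLY `Q(g) = Σ_ρ m(ρ) ĝ(ρ) conj ĝ(1 - ρ̄)` over the non-trivial zeros of `ζ`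
(explicit formula). With the tree's kernel-certified zero data (`RiemannHypothesisUpTo101`:
29 bracketed simple zeros up to height `101`; Ford's `Σ m(ρ)/|ρ|² ≤ 0.0463`) and the test
`g₀ = triangle(1/3) ⋆ bump(1/100)`, whose transform is `b² sinc²(bt/2) · η̂` on the line and
`O(1/γ²)` in the strip, the zero side is `≤ 7.5·10⁻⁴` while an atom at `|r| < 11` would cost
`≥ 9.3·10⁻⁴`.
-/


noncomputable section

open Complex Filter Set MeasureTheory
open scoped Real Topology ComplexConjugate ContDiff

namespace Summit.RiemannHypothesis.RiemannHypothesis.Cruxes.WindowTraceArch.LowZone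

open Literature.NumberTheory.LFunctions
open Literature.NumberTheory.LFunctions.ZetaZeros (riemannZetaNontrivialZeros)

/-! ## §A The located zeros of `ζ` up to height `101` (from the tree's `RH101` certificate) -/

/-- The 29 brackets `[a/2⁸, b/2⁸]` of `RiemannHypothesisUpTo101.lean` around `γ₁, …, γ₂₉`. -/
def bracketList : List (ℕ × ℕ) :=
  [(3606, 3630), (5370, 5394), (6391, 6415), (7777, 7801), (8419, 8443),
   (9610, 9634), (10463, 10487), (11080, 11104), (12277, 12301), (12730, 12754),
   (13548, 13572), (14438, 14462), (15181, 15205), (15561, 15585), (16657, 16681),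
   (17160, 17184), (17792, 17816), (18437, 18461), (19368, 19392), (19737, 19761),
   (20298, 20322), (21213, 21237), (21680, 21704), (22369, 22393), (22723, 22747),
   (23666, 23690), (24219, 24243), (24531, 24555), (25289, 25313)]

/-- The first ten brackets (zeros below `T* = 12754/2⁸ ≈ 49.82`). -/
def bracketList10 : List (ℕ × ℕ) :=
  [(3606, 3630), (5370, 5394), (6391, 6415), (7777, 7801), (8419, 8443),
   (9610, 9634), (10463, 10487), (11080, 11104), (12277, 12301), (12730, 12754)]

/-- Every bracket contains a zero of `ζ` on the critical line (kernel-checked in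
`RiemannHypothesisUpTo101.lean`, read through `Lagarias1999.zeros_of_checkZeros`). [folklore] -/
theorem exists_zero_of_mem_bracketList :
    ∀ ab ∈ bracketList, ∃ γ ∈ Icc ((ab.1 : ℝ) / 256) ((ab.2 : ℝ) / 256),
      riemannZeta (1 / 2 + γ * I) = 0 := by
  intro ab hab
  have h1 := Lagarias1999.zeros_of_checkZeros RH101.checkZeros₁
  have h2 := Lagarias1999.zeros_of_checkZeros RH101.checkZeros₂
  have h3 := Lagarias1999.zeros_of_checkZeros RH101.checkZeros₃
  have h4 := Lagarias1999.zeros_of_checkZeros RH101.checkZeros₄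
  have h5 := Lagarias1999.zeros_of_checkZeros RH101.checkZeros₅
  have h6 := Lagarias1999.zeros_of_checkZeros RH101.checkZeros₆
  have hsplit : bracketList =
      [(3606, 3630), (5370, 5394), (6391, 6415), (7777, 7801), (8419, 8443)] ++
      [(9610, 9634), (10463, 10487), (11080, 11104), (12277, 12301), (12730, 12754)] ++
      [(13548, 13572), (14438, 14462), (15181, 15205), (15561, 15585), (16657, 16681)] ++
      [(17160, 17184), (17792, 17816), (18437, 18461), (19368, 19392), (19737, 19761)] ++
      [(20298, 20322), (21213, 21237), (21680, 21704), (22369, 22393), (22723, 22747)] ++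
      [(23666, 23690), (24219, 24243), (24531, 24555), (25289, 25313)] := rfl
  rw [hsplit] at hab
  simp only [List.mem_append] at hab
  rcases hab with ((((h | h) | h) | h) | h) | h
  exacts [h1 ab h, h2 ab h, h3 ab h, h4 ab h, h5 ab h, h6 ab h]

/-- Numerical envelope of the bracket list. -/
theorem bracketList_bounds : ∀ ab ∈ bracketList, 3606 ≤ ab.1 ∧ ab.2 ≤ 25313 := by decide

/-- The brackets with left end point `≤ 12754` are the first ten. -/
theorem mem_bracketList10_of_fst_le : ∀ ab ∈ bracketList, ab.1 ≤ 12754 → ab ∈ bracketList10 := by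
  decide

/-- A chosen ordinate in each bracket (`0` off the list). -/
def pick (ab : ℕ × ℕ) : ℝ :=
  if h : ab ∈ bracketList then (exists_zero_of_mem_bracketList ab h).choose else 0

theorem pick_spec {ab : ℕ × ℕ} (h : ab ∈ bracketList) :
    pick ab ∈ Icc ((ab.1 : ℝ) / 256) ((ab.2 : ℝ) / 256) ∧ riemannZeta (1 / 2 + pick ab * I) = 0 := by
  have := (exists_zero_of_mem_bracketList ab h).choose_spec
  simp only [pick, h, dite_true]
  exact ⟨this.1, this.2⟩

/-- The brackets are listed in increasing order and are pairwise separated. -/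
theorem bracketList_pairwise : bracketList.Pairwise fun ab ab' => ab.2 < ab'.1 := by
  decide

/-- The picked ordinates are strictly increasing along the list. -/
theorem pick_pairwise : (bracketList.map pick).Pairwise (· < ·) := by
  rw [List.pairwise_map]
  refine bracketList_pairwise.imp_of_mem ?_
  intro ab ab' hab hab' hlt
  have h1 := (pick_spec hab).1.2
  have h2 := (pick_spec hab').1.1
  have h3 : ((ab.2 : ℝ) / 256) < (ab'.1 : ℝ) / 256 := by
    have : (ab.2 : ℝ) < ab'.1 := by exact_mod_cast hlt
    linarith
  linarith

theorem pick_nodup : (bracketList.map pick).Nodup :=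
  pick_pairwise.imp fun h => h.ne

/-- The finset of the 29 located ordinates. -/
def Zfin : Finset ℝ := (bracketList.map pick).toFinset

theorem card_Zfin : Zfin.card = 29 := by
  rw [Zfin, List.toFinset_card_of_nodup pick_nodup, List.length_map]
  rfl

theorem mem_Zfin_iff {t : ℝ} : t ∈ Zfin ↔ ∃ ab ∈ bracketList, pick ab = t := by
  simp [Zfin]

/-- **The zeros of `ζ` up to height `101`** are simple, on the critical line, and their ordinates
are the 29 located ones (Brent's `H(n)` criterion with `N(101) = 29`). [folklore] -/
theorem zeros_upTo_101 {ρ : ℂ} (hz : riemannZeta ρ = 0) (h0 : 0 < ρ.im) (h1 : ρ.im ≤ 101) :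
    ρ.re = 1 / 2 ∧ deriv riemannZeta ρ ≠ 0 ∧ ρ.im ∈ Zfin := by
  have hZ : ∀ γ ∈ Zfin, riemannZeta (1 / 2 + γ * I) = 0 ∧ 0 < γ ∧ γ ≤ 101 := by
    intro γ hγ
    obtain ⟨ab, hab, rfl⟩ := mem_Zfin_iff.1 hγ
    obtain ⟨⟨hlo, hhi⟩, hζ⟩ := pick_spec hab
    have hab1 : (3606 : ℝ) ≤ ab.1 ∧ (ab.2 : ℝ) ≤ 25313 := by
      obtain ⟨h1, h2⟩ := bracketList_bounds ab hab
      exact ⟨by exact_mod_cast h1, by exact_mod_cast h2⟩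
    refine ⟨hζ, ?_, ?_⟩
    · have : (0 : ℝ) < (ab.1 : ℝ) / 256 := by linarith [hab1.1]
      linarith
    · have : (ab.2 : ℝ) / 256 ≤ 101 := by linarith [hab1.2]
      linarith
  have hN : zetaZeroCount 101 ≤ Zfin.card := by
    rw [zetaZeroCount_hundredOne, card_Zfin]
  exact (simple_onLine_upTo_of_located_zeros (T := 101) Zfin hZ hN).1 ρ hz h0 h1

/-- The height below which the ten first brackets lie: `T* = 12754/2⁸`. -/
def Tstar : ℝ := 12754 / 256

/-- A located ordinate `≤ T*` comes from one of the first ten brackets. -/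
theorem mem_bracketList10_of_pick_le {ab : ℕ × ℕ} (hab : ab ∈ bracketList) (h : pick ab ≤ Tstar) :
    ab ∈ bracketList10 := by
  have hlo := (pick_spec hab).1.1
  refine mem_bracketList10_of_fst_le ab hab ?_
  have h1 : (ab.1 : ℝ) / 256 ≤ 12754 / 256 := hlo.trans h
  have h2 : (ab.1 : ℝ) ≤ 12754 := by linarith
  exact_mod_cast h2

/-- **Low zeros.** A non-trivial zero `ρ` with `|Im ρ| ≤ T*` lies on the critical line, is simple
(`m(ρ) = 1`), and `|Im ρ| = pick ab` for one of the first ten brackets `ab`. [folklore] -/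
theorem low_zero {ρ : ℂ} (hρ : ρ ∈ riemannZetaNontrivialZeros) (hT : |ρ.im| ≤ Tstar) :
    ρ.re = 1 / 2 ∧ riemannZetaZeroOrder ρ = 1 ∧ ∃ ab ∈ bracketList10, |ρ.im| = pick ab := by
  have hT101 : Tstar ≤ 101 := by norm_num [Tstar]
  have him : ρ.im ≠ 0 := ZetaZeros.riemannZetaNontrivialZeros.im_ne_zero hρ
  rcases lt_or_gt_of_ne him with hneg | hpos
  · -- `Im ρ < 0`: work with `conj ρ`
    have hc : conj ρ ∈ riemannZetaNontrivialZeros := ZetaZeros.riemannZetaNontrivialZeros.conj_mem hρ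
    have h0 : 0 < (conj ρ).im := by simp; linarith
    have h1 : (conj ρ).im ≤ 101 := by
      simp only [conj_im]
      have : |ρ.im| = -ρ.im := abs_of_neg hneg
      linarith
    obtain ⟨hre, hd, hmem⟩ := zeros_upTo_101 (ZetaZeros.riemannZetaNontrivialZeros.zeta_eq_zero hc) h0 h1
    have hord : riemannZetaZeroOrder (conj ρ) = 1 :=
      (riemannZetaZeroOrder_eq_one_iff_deriv_ne_zero hc).2 hd
    refine ⟨by simpa using hre, ?_, ?_⟩
    · rw [← riemannZetaZeroOrder_conj_holds ρ]; exact hord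
    · obtain ⟨ab, hab, hab'⟩ := mem_Zfin_iff.1 hmem
      have habs : |ρ.im| = pick ab := by rw [hab', conj_im, abs_of_neg hneg]
      exact ⟨ab, mem_bracketList10_of_pick_le hab (habs ▸ hT), habs⟩
  · have h1 : ρ.im ≤ 101 := by
      have : |ρ.im| = ρ.im := abs_of_pos hpos
      linarith
    obtain ⟨hre, hd, hmem⟩ := zeros_upTo_101 (ZetaZeros.riemannZetaNontrivialZeros.zeta_eq_zero hρ) hpos h1
    have hord : riemannZetaZeroOrder ρ = 1 :=
      (riemannZetaZeroOrder_eq_one_iff_deriv_ne_zero hρ).2 hd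
    refine ⟨hre, hord, ?_⟩
    obtain ⟨ab, hab, hab'⟩ := mem_Zfin_iff.1 hmem
    have habs : |ρ.im| = pick ab := by rw [hab', abs_of_pos hpos]
    exact ⟨ab, mem_bracketList10_of_pick_le hab (habs ▸ hT), habs⟩

/-! ## §B The zero side of the quadratic functional -/

/-- The summand `U_g(ρ) = m(ρ) ‖ĝ(ρ)‖ ‖ĝ(1 - ρ̄)‖` majorising the zero side of `Q(g)`. -/
def zeroTerm (g : ℝ → ℂ) (ρ : ℂ) : ℝ :=
  (riemannZetaZeroOrder ρ : ℝ) * ‖weilMellin g ρ‖ * ‖weilMellin g (1 - conj ρ)‖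

theorem zeroTerm_nonneg (g : ℝ → ℂ) {ρ : ℂ} (hρ : ρ ∈ riemannZetaNontrivialZeros) :
    0 ≤ zeroTerm g ρ := by
  have h1 : (0 : ℝ) ≤ riemannZetaZeroOrder ρ := by
    exact_mod_cast (riemannZetaZeroOrder_nonneg (ZetaZeros.riemannZetaNontrivialZeros.ne_one hρ))
  unfold zeroTerm
  positivity

/-- The zero side of `Q(g) = W(g ⋆ g̃)`: the norm of the `ρ`-th term of the explicit formula for
`g ⋆ g̃` IS `U_g(ρ)` (`(g ⋆ g̃)^(s) = ĝ(s) conj ĝ(1 - s̄)`). [folklore] -/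
theorem norm_term_weilConv_weilReflect {g : ℝ → ℂ} (hg : IsWeilTest g) {ρ : ℂ}
    (hρ : ρ ∈ riemannZetaNontrivialZeros) :
    ‖(riemannZetaZeroOrder ρ : ℂ) * weilMellin (weilConv g (weilReflect g)) ρ‖ = zeroTerm g ρ := by
  have h1 : (0 : ℝ) ≤ riemannZetaZeroOrder ρ := by
    exact_mod_cast (riemannZetaZeroOrder_nonneg (ZetaZeros.riemannZetaNontrivialZeros.ne_one hρ))
  rw [weilMellin_weilQuadratic hg ρ, norm_mul, norm_mul, Complex.norm_intCast, abs_of_nonneg h1,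
    Complex.norm_conj, zeroTerm, mul_assoc]

/-- Summability of the zero side of `Q(g)`. [folklore] -/
theorem summable_zeroTerm {g : ℝ → ℂ} (hg : IsWeilTest g) :
    Summable fun ρ : riemannZetaNontrivialZeros => zeroTerm g ρ := by
  have hk : IsWeilTest (weilConv g (weilReflect g)) := hg.weilConv hg.weilReflect
  refine (summable_norm_zeroSide hk).congr fun ρ => ?_
  exact norm_term_weilConv_weilReflect hg ρ.2

/-- **The quadratic functional is bounded by the zero side**: unconditionally
`Re Q(g) ≤ Σ_ρ m(ρ) ‖ĝ(ρ)‖ ‖ĝ(1 - ρ̄)‖` (explicit formula for `g ⋆ g̃`, absolute convergence).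
[folklore] -/
theorem re_weilQuadratic_le_tsum_zeroTerm {g : ℝ → ℂ} (hg : IsWeilTest g) :
    (weilQuadratic g).re ≤ ∑' ρ : riemannZetaNontrivialZeros, zeroTerm g ρ := by
  have hk : IsWeilTest (weilConv g (weilReflect g)) := hg.weilConv hg.weilReflect
  have hS := summable_norm_zeroSide hk
  have hEF : ∑' ρ : riemannZetaNontrivialZeros,
      (riemannZetaZeroOrder (ρ : ℂ) : ℂ) * weilMellin (weilConv g (weilReflect g)) ρ =
        weilQuadratic g :=
    tendsto_nhds_unique (hasWeilZeroSide_tsum hS) (explicit_formula_holds hk)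
  calc (weilQuadratic g).re ≤ ‖weilQuadratic g‖ := Complex.re_le_norm _
    _ = ‖∑' ρ : riemannZetaNontrivialZeros,
          (riemannZetaZeroOrder (ρ : ℂ) : ℂ) * weilMellin (weilConv g (weilReflect g)) ρ‖ := by
        rw [hEF]
    _ ≤ ∑' ρ : riemannZetaNontrivialZeros,
          ‖(riemannZetaZeroOrder (ρ : ℂ) : ℂ) * weilMellin (weilConv g (weilReflect g)) ρ‖ :=
        norm_tsum_le_tsum_norm hS
    _ = ∑' ρ : riemannZetaNontrivialZeros, zeroTerm g ρ :=
        tsum_congr fun ρ => norm_term_weilConv_weilReflect hg ρ.2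

/-- The set of low zeros `|Im ρ| ≤ T*` is finite. -/
theorem finite_lowZeros : {ρ : riemannZetaNontrivialZeros | |(ρ : ℂ).im| ≤ Tstar}.Finite := by
  have h := weilZeroIndex_finite Tstar
  rw [weilZeroIndex_eq_inter] at h
  have : {ρ : riemannZetaNontrivialZeros | |(ρ : ℂ).im| ≤ Tstar} =
      ((↑) : riemannZetaNontrivialZeros → ℂ) ⁻¹' (riemannZetaNontrivialZeros ∩ {ρ | |ρ.im| ≤ Tstar}) := by
    ext ρ
    simp
  rw [this]
  exact h.preimage Subtype.coe_injective.injOn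

/-- The finset of low zeros. -/
def lowZeros : Finset riemannZetaNontrivialZeros := finite_lowZeros.toFinset

theorem mem_lowZeros {ρ : riemannZetaNontrivialZeros} : ρ ∈ lowZeros ↔ |(ρ : ℂ).im| ≤ Tstar := by
  simp [lowZeros]

/-- Splitting the zero side at height `T*`: finite low part plus the high tail. [folklore] -/
theorem tsum_zeroTerm_eq_add {g : ℝ → ℂ} (hg : IsWeilTest g) :
    ∑' ρ : riemannZetaNontrivialZeros, zeroTerm g ρ =
      ∑ ρ ∈ lowZeros, zeroTerm g ρ +
        ∑' ρ : {ρ : riemannZetaNontrivialZeros // ρ ∉ lowZeros}, zeroTerm g ρ :=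
  ((summable_zeroTerm hg).sum_add_tsum_subtype_compl lowZeros).symm


/-! ## §C The test function, I: the triangle `Λ_b` and its transform -/

section Triangle

/-- The triangle `Λ_b(u) = max (b - |u|) 0`, as a complex-valued function. -/
def tri (b : ℝ) (u : ℝ) : ℂ := ((max (b - |u|) 0 : ℝ) : ℂ)

theorem continuous_tri (b : ℝ) : Continuous (tri b) :=
  Complex.continuous_ofReal.comp ((continuous_const.sub continuous_abs).max continuous_const)

theorem tri_of_abs_le {b u : ℝ} (h : |u| ≤ b) : tri b u = ((b - |u| : ℝ) : ℂ) := by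
  simp [tri, max_eq_left (sub_nonneg.2 h)]

theorem tri_of_le_abs {b u : ℝ} (h : b ≤ |u|) : tri b u = 0 := by
  simp [tri, max_eq_right (sub_nonpos.2 h)]

theorem norm_tri_le {b : ℝ} (hb : 0 ≤ b) (u : ℝ) : ‖tri b u‖ ≤ b := by
  rw [tri, Complex.norm_real, Real.norm_eq_abs, abs_of_nonneg (le_max_right _ _)]
  exact max_le (by linarith [abs_nonneg u]) hb

theorem support_tri_subset (b : ℝ) : Function.support (tri b) ⊆ Icc (-b) b := by
  intro u hu
  by_contra h
  apply hu
  apply tri_of_le_abs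
  rw [mem_Icc, not_and_or, not_le, not_le] at h
  rcases h with h | h
  · linarith [neg_le_abs u]
  · linarith [le_abs_self u]

theorem tsupport_tri_subset (b : ℝ) : tsupport (tri b) ⊆ Icc (-b) b :=
  closure_minimal (support_tri_subset b) isClosed_Icc

theorem hasCompactSupport_tri (b : ℝ) : HasCompactSupport (tri b) :=
  HasCompactSupport.of_support_subset_isCompact isCompact_Icc (support_tri_subset b)

/-- Antiderivative on `[0, b]`: `d/du [((b-u)z+1) e^{zu} / z²] = (b-u) e^{zu}`. [folklore] -/
theorem hasDerivAt_triPrim₁ (b : ℝ) {z : ℂ} (hz : z ≠ 0) (u : ℝ) :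
    HasDerivAt (fun u : ℝ => (((b : ℂ) - u) * z + 1) * cexp (z * u) / z ^ 2)
      (((b : ℂ) - u) * cexp (z * u)) u := by
  have hu : HasDerivAt (fun u : ℝ => (u : ℂ)) 1 u := (hasDerivAt_id u).ofReal_comp
  have h1 : HasDerivAt (fun u : ℝ => ((b : ℂ) - u) * z + 1) (-z) u := by
    have := ((hu.const_sub (b : ℂ)).mul_const z).add_const 1
    simpa using this
  have h2 : HasDerivAt (fun u : ℝ => cexp (z * u)) (z * cexp (z * u)) u := by
    have := (hu.const_mul z).cexp
    simpa [mul_comm] using this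
  refine ((h1.mul h2).div_const (z ^ 2)).congr_deriv ?_
  field_simp
  ring

/-- Antiderivative on `[-b, 0]`: `d/du [((b+u)z-1) e^{zu} / z²] = (b+u) e^{zu}`. [folklore] -/
theorem hasDerivAt_triPrim₂ (b : ℝ) {z : ℂ} (hz : z ≠ 0) (u : ℝ) :
    HasDerivAt (fun u : ℝ => (((b : ℂ) + u) * z - 1) * cexp (z * u) / z ^ 2)
      (((b : ℂ) + u) * cexp (z * u)) u := by
  have hu : HasDerivAt (fun u : ℝ => (u : ℂ)) 1 u := (hasDerivAt_id u).ofReal_comp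
  have h1 : HasDerivAt (fun u : ℝ => ((b : ℂ) + u) * z - 1) z u := by
    have := ((hu.const_add (b : ℂ)).mul_const z).sub_const 1
    simpa using this
  have h2 : HasDerivAt (fun u : ℝ => cexp (z * u)) (z * cexp (z * u)) u := by
    have := (hu.const_mul z).cexp
    simpa [mul_comm] using this
  refine ((h1.mul h2).div_const (z ^ 2)).congr_deriv ?_
  field_simp
  ring

/-- **Transform of the triangle**: for `z = s - 1/2 ≠ 0`,
`Λ̂_b(s) = (e^{bz} + e^{-bz} - 2)/z²`. [folklore] -/
theorem weilMellin_tri {b : ℝ} (hb : 0 ≤ b) {s : ℂ} (hs : s - 1 / 2 ≠ 0) :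
    weilMellin (tri b) s =
      (cexp ((s - 1 / 2) * b) + cexp (-((s - 1 / 2) * b)) - 2) / (s - 1 / 2) ^ 2 := by
  have hz : s - 1 / 2 ≠ 0 := hs
  unfold weilMellin
  rw [integral_eq_intervalIntegral_of_tsupport (continuous_tri b) (tsupport_tri_subset b)]
  have hint : ∀ c d : ℝ, IntervalIntegrable (fun u : ℝ => tri b u * cexp ((s - 1 / 2) * u)) volume c d :=
    fun c d => ((continuous_tri b).mul (by fun_prop)).intervalIntegrable _ _
  rw [← intervalIntegral.integral_add_adjacent_intervals (hint (-b) 0) (hint 0 b)]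
  -- the piece `[-b, 0]`
  have hL : ∫ u in (-b)..0, tri b u * cexp ((s - 1 / 2) * u) =
      ∫ u in (-b)..0, ((b : ℂ) + u) * cexp ((s - 1 / 2) * u) := by
    refine intervalIntegral.integral_congr fun u hu => ?_
    rw [uIcc_of_le (by linarith), mem_Icc] at hu
    have habs : |u| = -u := abs_of_nonpos hu.2
    rw [tri_of_abs_le (by rw [habs]; linarith), habs]
    push_cast
    ring_nf
  have hR : ∫ u in (0 : ℝ)..b, tri b u * cexp ((s - 1 / 2) * u) =
      ∫ u in (0 : ℝ)..b, ((b : ℂ) - u) * cexp ((s - 1 / 2) * u) := by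
    refine intervalIntegral.integral_congr fun u hu => ?_
    rw [uIcc_of_le hb, mem_Icc] at hu
    have habs : |u| = u := abs_of_nonneg hu.1
    rw [tri_of_abs_le (by rw [habs]; linarith), habs]
    push_cast
    ring_nf
  rw [hL, hR]
  rw [intervalIntegral.integral_eq_sub_of_hasDerivAt (fun u _ => hasDerivAt_triPrim₂ b hz u)
      ((Continuous.continuousOn (by fun_prop)).intervalIntegrable),
    intervalIntegral.integral_eq_sub_of_hasDerivAt (fun u _ => hasDerivAt_triPrim₁ b hz u)
      ((Continuous.continuousOn (by fun_prop)).intervalIntegrable)]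
  simp only [Complex.ofReal_neg, Complex.ofReal_zero, mul_zero, Complex.exp_zero, mul_one, add_zero,
    sub_zero, mul_neg]
  field_simp
  ring_nf

/-- The transform of the triangle at the centre: `Λ̂_b(1/2) = b²`. [folklore] -/
theorem weilMellin_tri_half {b : ℝ} (hb : 0 ≤ b) : weilMellin (tri b) (1 / 2) = (b : ℂ) ^ 2 := by
  unfold weilMellin
  rw [integral_eq_intervalIntegral_of_tsupport (continuous_tri b) (tsupport_tri_subset b)]
  simp only [sub_self, zero_mul, Complex.exp_zero, mul_one]
  have hint : ∀ c d : ℝ, IntervalIntegrable (tri b) volume c d :=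
    fun c d => (continuous_tri b).intervalIntegrable _ _
  rw [← intervalIntegral.integral_add_adjacent_intervals (hint (-b) 0) (hint 0 b)]
  have hL : ∫ u in (-b)..0, tri b u = ∫ u in (-b)..0, ((b : ℂ) + u) := by
    refine intervalIntegral.integral_congr fun u hu => ?_
    rw [uIcc_of_le (by linarith), mem_Icc] at hu
    have habs : |u| = -u := abs_of_nonpos hu.2
    rw [tri_of_abs_le (by rw [habs]; linarith), habs]
    push_cast
    ring
  have hR : ∫ u in (0 : ℝ)..b, tri b u = ∫ u in (0 : ℝ)..b, ((b : ℂ) - u) := by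
    refine intervalIntegral.integral_congr fun u hu => ?_
    rw [uIcc_of_le hb, mem_Icc] at hu
    have habs : |u| = u := abs_of_nonneg hu.1
    rw [tri_of_abs_le (by rw [habs]; linarith), habs]
    push_cast
    ring
  have hofR : ∀ c d : ℝ, IntervalIntegrable (fun u : ℝ => (u : ℂ)) volume c d :=
    fun c d => Complex.continuous_ofReal.intervalIntegrable _ _
  have i1 : ∫ u in (-b)..0, ((b : ℂ) + u) = (b : ℂ) ^ 2 / 2 := by
    rw [intervalIntegral.integral_add intervalIntegrable_const (hofR _ _),
      intervalIntegral.integral_const, intervalIntegral.integral_ofReal, integral_id]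
    simp only [Complex.real_smul]
    push_cast
    ring
  have i2 : ∫ u in (0 : ℝ)..b, ((b : ℂ) - u) = (b : ℂ) ^ 2 / 2 := by
    rw [intervalIntegral.integral_sub intervalIntegrable_const (hofR _ _),
      intervalIntegral.integral_const, intervalIntegral.integral_ofReal, integral_id]
    simp only [Complex.real_smul]
    push_cast
    ring
  rw [hL, hR, i1, i2]
  ring

/-- On the critical line the transform of the triangle is the Fejér-type kernel
`Λ̂_b(1/2 + it) = b² sinc²(bt/2)` (for all real `t`). [folklore] -/
theorem weilMellin_tri_line {b : ℝ} (hb : 0 ≤ b) (t : ℝ) :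
    weilMellin (tri b) (1 / 2 + t * I) = ((b ^ 2 * Real.sinc (b * t / 2) ^ 2 : ℝ) : ℂ) := by
  rcases eq_or_ne t 0 with rfl | ht
  · have h0 : (1 / 2 : ℂ) + ((0 : ℝ) : ℂ) * I = 1 / 2 := by simp
    rw [h0, weilMellin_tri_half hb]
    simp
  by_cases hb0 : b = 0
  · subst hb0
    have htri : tri 0 = fun _ => 0 := by
      funext u
      simp [tri]
    simp [weilMellin, htri]
  have hz : (1 / 2 + (t : ℂ) * I) - 1 / 2 ≠ 0 := by
    intro h
    have := congrArg Complex.im h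
    simp at this
    exact ht this
  rw [weilMellin_tri hb hz]
  have e1 : (1 / 2 + (t : ℂ) * I - 1 / 2) = (t : ℂ) * I := by ring
  rw [e1]
  have e2 : cexp ((t : ℂ) * I * b) + cexp (-((t : ℂ) * I * b)) = 2 * Complex.cos ((b * t : ℝ) : ℂ) := by
    rw [Complex.two_cos]
    congr 1 <;> congr 1 <;> push_cast <;> ring
  have e3 : ((t : ℂ) * I) ^ 2 = -((t : ℂ) ^ 2) := by
    rw [mul_pow, Complex.I_sq]; ring
  rw [e2, e3, ← Complex.ofReal_cos]
  have hbt : b * t / 2 ≠ 0 := by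
    have : b * t ≠ 0 := mul_ne_zero hb0 ht
    intro h; apply this; linear_combination (2 : ℝ) * h
  have hsinc : Real.sinc (b * t / 2) = Real.sin (b * t / 2) / (b * t / 2) := Real.sinc_of_ne_zero hbt
  have hcos : Real.cos (b * t) = 1 - 2 * Real.sin (b * t / 2) ^ 2 := by
    have := Real.cos_two_mul (b * t / 2)
    have h2 := Real.sin_sq_add_cos_sq (b * t / 2)
    rw [show 2 * (b * t / 2) = b * t by ring] at this
    nlinarith
  rw [hsinc, hcos]
  have ht' : (t : ℂ) ≠ 0 := Complex.ofReal_ne_zero.2 ht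
  have hb' : (b : ℂ) ≠ 0 := Complex.ofReal_ne_zero.2 hb0
  push_cast
  field_simp
  ring

/-- `b² sinc²(bt/2) = 4 sin²(bt/2)/t²` for `t ≠ 0`. [folklore] -/
theorem sq_mul_sinc_sq_eq {b t : ℝ} (ht : t ≠ 0) :
    b ^ 2 * Real.sinc (b * t / 2) ^ 2 = 4 * Real.sin (b * t / 2) ^ 2 / t ^ 2 := by
  by_cases hb : b = 0
  · subst hb; simp
  have hbt : b * t / 2 ≠ 0 := by
    have : b * t ≠ 0 := mul_ne_zero hb ht
    intro h; apply this; linarith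
  rw [Real.sinc_of_ne_zero hbt]
  field_simp
  ring

/-- The Fejér kernel is bounded by `4/t²`. [folklore] -/
theorem sq_mul_sinc_sq_le_div {b t : ℝ} (ht : t ≠ 0) :
    b ^ 2 * Real.sinc (b * t / 2) ^ 2 ≤ 4 / t ^ 2 := by
  rw [sq_mul_sinc_sq_eq ht]
  have h1 : Real.sin (b * t / 2) ^ 2 ≤ 1 := by
    rw [sq_le_one_iff_abs_le_one]; exact Real.abs_sin_le_one _
  have h2 : 0 < t ^ 2 := by positivity
  rw [div_le_div_iff_of_pos_right h2]
  linarith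

/-- **Strip bound for the triangle**: for `0 ≤ Re s ≤ 1`, `Im s ≠ 0`,
`‖Λ̂_b(s)‖ ≤ (2 e^{b/2} + 2)/(Im s)²`. [folklore] -/
theorem norm_weilMellin_tri_le {b : ℝ} (hb : 0 ≤ b) {s : ℂ} (hs0 : 0 ≤ s.re) (hs1 : s.re ≤ 1)
    (hsi : s.im ≠ 0) :
    ‖weilMellin (tri b) s‖ ≤ (2 * Real.exp (b / 2) + 2) / s.im ^ 2 := by
  have hz : s - 1 / 2 ≠ 0 := by
    intro h
    have := congrArg Complex.im h
    simp at this
    exact hsi this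
  rw [weilMellin_tri hb hz, norm_div, norm_pow]
  have hre : |(s - 1 / 2).re| ≤ 1 / 2 := by
    rw [abs_le]; constructor <;> simp <;> linarith
  have him : (s - 1 / 2).im = s.im := by simp
  -- numerator
  have hnum : ‖cexp ((s - 1 / 2) * b) + cexp (-((s - 1 / 2) * b)) - 2‖ ≤ 2 * Real.exp (b / 2) + 2 := by
    have h1 : ‖cexp ((s - 1 / 2) * b)‖ ≤ Real.exp (b / 2) := by
      rw [Complex.norm_exp]
      refine Real.exp_le_exp.2 ?_
      have : ((s - 1 / 2) * (b : ℂ)).re = (s - 1 / 2).re * b := by simp [Complex.mul_re]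
      rw [this]
      nlinarith [abs_le.1 hre]
    have h2 : ‖cexp (-((s - 1 / 2) * b))‖ ≤ Real.exp (b / 2) := by
      rw [Complex.norm_exp]
      refine Real.exp_le_exp.2 ?_
      have : (-((s - 1 / 2) * (b : ℂ))).re = -((s - 1 / 2).re * b) := by simp [Complex.mul_re]
      rw [this]
      nlinarith [abs_le.1 hre]
    calc ‖cexp ((s - 1 / 2) * b) + cexp (-((s - 1 / 2) * b)) - 2‖
        ≤ ‖cexp ((s - 1 / 2) * b)‖ + ‖cexp (-((s - 1 / 2) * b))‖ + ‖(2 : ℂ)‖ := norm_sub_le_of_le (norm_add_le _ _) le_rfl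
      _ ≤ Real.exp (b / 2) + Real.exp (b / 2) + 2 := by
          have : ‖(2 : ℂ)‖ = 2 := by simp
          linarith
      _ = 2 * Real.exp (b / 2) + 2 := by ring
  -- denominator
  have hden : s.im ^ 2 ≤ ‖s - 1 / 2‖ ^ 2 := by
    rw [← him]
    have := Complex.abs_im_le_norm (s - 1 / 2)
    rw [← sq_abs]
    exact pow_le_pow_left₀ (abs_nonneg _) this 2
  have hpos : 0 < s.im ^ 2 := by positivity
  calc ‖cexp ((s - 1 / 2) * b) + cexp (-((s - 1 / 2) * b)) - 2‖ / ‖s - 1 / 2‖ ^ 2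
      ≤ (2 * Real.exp (b / 2) + 2) / ‖s - 1 / 2‖ ^ 2 :=
        div_le_div_of_nonneg_right hnum (by positivity)
    _ ≤ (2 * Real.exp (b / 2) + 2) / s.im ^ 2 :=
        div_le_div_of_nonneg_left (by positivity) hpos hden

end Triangle


/-! ## §C The test function, II: the mollifier `η` and `g₀ = Λ_{1/3} ⋆ η` -/

section TestFunction

/-- A fixed smooth bump at `0` with outer radius `1/100`. -/
def bump0 : ContDiffBump (0 : ℝ) := ⟨1 / 200, 1 / 100, by norm_num, by norm_num⟩

/-- The mollifier `η`: the bump normalised to unit mass (real-valued). -/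
def η : ℝ → ℝ := bump0.normed volume

/-- The mollifier as a complex-valued function. -/
def ηc (u : ℝ) : ℂ := (η u : ℂ)

theorem η_nonneg (u : ℝ) : 0 ≤ η u := bump0.nonneg_normed u

theorem integral_η : ∫ u, η u = 1 := bump0.integral_normed

theorem contDiff_η : ContDiff ℝ ∞ η := bump0.contDiff_normed

theorem continuous_η : Continuous η := bump0.continuous_normed

theorem tsupport_η : tsupport η = Metric.closedBall (0 : ℝ) (1 / 100) := bump0.tsupport_normed_eq

theorem η_eq_zero_of_lt {u : ℝ} (hu : 1 / 100 < |u|) : η u = 0 := by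
  apply image_eq_zero_of_notMem_tsupport
  rw [tsupport_η, Metric.mem_closedBall, dist_zero_right, Real.norm_eq_abs, not_le]
  exact hu

theorem integrable_η : Integrable η := bump0.integrable_normed

theorem isWeilTest_ηc : IsWeilTest ηc :=
  ⟨Complex.ofRealCLM.contDiff.comp contDiff_η,
    bump0.hasCompactSupport_normed.comp_left Complex.ofReal_zero⟩

theorem continuous_ηc : Continuous ηc := Complex.continuous_ofReal.comp continuous_η

theorem tsupport_ηc_subset : tsupport ηc ⊆ Icc (-(1 / 100)) (1 / 100) := by
  refine (tsupport_comp_subset Complex.ofReal_zero _).trans ?_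
  rw [tsupport_η, Real.closedBall_eq_Icc, zero_sub, zero_add]

theorem norm_ηc (u : ℝ) : ‖ηc u‖ = η u := by
  rw [ηc, Complex.norm_real, Real.norm_eq_abs, abs_of_nonneg (η_nonneg u)]

/-- `‖η̂(s)‖ ≤ e^{1/200}` in the closed strip. [folklore] -/
theorem norm_weilMellin_ηc_le {s : ℂ} (hs0 : 0 ≤ s.re) (hs1 : s.re ≤ 1) :
    ‖weilMellin ηc s‖ ≤ Real.exp (1 / 200) := by
  refine (norm_weilMellin_le_weilL1 continuous_ηc isWeilTest_ηc.2 hs0 hs1).trans ?_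
  unfold weilL1
  have hpt : ∀ t : ℝ, ‖ηc t‖ * Real.exp (|t| / 2) ≤ Real.exp (1 / 200) * η t := by
    intro t
    rw [norm_ηc]
    by_cases ht : 1 / 100 < |t|
    · rw [η_eq_zero_of_lt ht]; simp
    · rw [not_lt] at ht
      rw [mul_comm]
      refine mul_le_mul_of_nonneg_right (Real.exp_le_exp.2 (by linarith)) (η_nonneg t)
  calc ∫ t : ℝ, ‖ηc t‖ * Real.exp (|t| / 2) ≤ ∫ t : ℝ, Real.exp (1 / 200) * η t := by
        refine integral_mono_of_nonneg (Eventually.of_forall fun t => by positivity)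
          (integrable_η.const_mul _) (Eventually.of_forall hpt)
    _ = Real.exp (1 / 200) := by rw [MeasureTheory.integral_const_mul, integral_η, mul_one]

/-- `‖η̂(1/2 + it)‖ ≤ 1` on the critical line (unit mass). [folklore] -/
theorem norm_weilMellin_ηc_line_le (t : ℝ) : ‖weilMellin ηc (1 / 2 + t * I)‖ ≤ 1 := by
  unfold weilMellin
  calc ‖∫ u : ℝ, ηc u * cexp ((1 / 2 + t * I - 1 / 2) * u)‖
      ≤ ∫ u : ℝ, ‖ηc u * cexp ((1 / 2 + t * I - 1 / 2) * u)‖ := norm_integral_le_integral_norm _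
    _ = ∫ u : ℝ, η u := by
        refine integral_congr_ae (Eventually.of_forall fun u => ?_)
        have e : (1 / 2 + (t : ℂ) * I - 1 / 2) * (u : ℂ) = ((t * u : ℝ) : ℂ) * I := by
          push_cast; ring
        simp only [norm_mul, norm_ηc, e, Complex.norm_exp_ofReal_mul_I, mul_one]
    _ = 1 := integral_η

/-- `Re η̂(1/2 + it) ≥ cos(|t|/100)` for `|t| ≤ 100 π` (the bump is non-negative of unit mass and
lives on `|u| ≤ 1/100`). [folklore] -/
theorem cos_le_re_weilMellin_ηc_line {t : ℝ} (ht : |t| / 100 ≤ π) :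
    Real.cos (|t| / 100) ≤ (weilMellin ηc (1 / 2 + t * I)).re := by
  have hint : Integrable fun u : ℝ => ηc u * cexp ((1 / 2 + t * I - 1 / 2) * u) :=
    integrable_weilIntegrand continuous_ηc isWeilTest_ηc.2 _
  have hre : (weilMellin ηc (1 / 2 + t * I)).re = ∫ u, η u * Real.cos (t * u) := by
    unfold weilMellin
    have hre' := integral_re hint
    simp only [RCLike.re_to_complex] at hre'
    rw [← hre']
    refine integral_congr_ae (Eventually.of_forall fun u => ?_)
    have e : (1 / 2 + (t : ℂ) * I - 1 / 2) * (u : ℂ) = ((t * u : ℝ) : ℂ) * I := by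
      push_cast; ring
    simp only [ηc]
    rw [e, Complex.re_ofReal_mul, Complex.exp_ofReal_mul_I_re]
  rw [hre]
  have hpt : ∀ u : ℝ, Real.cos (|t| / 100) * η u ≤ η u * Real.cos (t * u) := by
    intro u
    by_cases hu : 1 / 100 < |u|
    · rw [η_eq_zero_of_lt hu]; simp
    · rw [not_lt] at hu
      rw [mul_comm]
      refine mul_le_mul_of_nonneg_left ?_ (η_nonneg u)
      rw [← Real.cos_abs (t * u)]
      refine Real.cos_le_cos_of_nonneg_of_le_pi (abs_nonneg _) ht ?_
      rw [abs_mul]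
      have : |t| * |u| ≤ |t| * (1 / 100) := mul_le_mul_of_nonneg_left hu (abs_nonneg t)
      linarith
  calc Real.cos (|t| / 100) = ∫ u, Real.cos (|t| / 100) * η u := by
        rw [MeasureTheory.integral_const_mul, integral_η, mul_one]
    _ ≤ ∫ u, η u * Real.cos (t * u) := by
        refine integral_mono (integrable_η.const_mul _) ?_ hpt
        exact (continuous_η.mul (by fun_prop)).integrable_of_hasCompactSupport
          bump0.hasCompactSupport_normed.mul_right

/-- The half-width of the triangle: `b = 1/3`. -/
def b₀ : ℝ := 1 / 3

/-- **The test function** `g₀ = Λ_{1/3} ⋆ η`. -/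
def g₀ : ℝ → ℂ := weilConv (tri b₀) ηc

theorem isWeilTest_g₀ : IsWeilTest g₀ := by
  unfold g₀
  rw [weilConv_eq_convolution_real]
  exact ⟨isWeilTest_ηc.2.contDiff_convolution_right (ContinuousLinearMap.mul ℝ ℂ)
      (continuous_tri b₀).locallyIntegrable isWeilTest_ηc.1,
    HasCompactSupport.convolution (L := ContinuousLinearMap.mul ℝ ℂ) (hasCompactSupport_tri b₀)
      isWeilTest_ηc.2⟩

/-- `supp g₀ ⊆ [-(1/3 + 1/100), 1/3 + 1/100]`. -/
theorem tsupport_g₀_subset : tsupport g₀ ⊆ Icc (-(b₀ + 1 / 100)) (b₀ + 1 / 100) := by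
  refine (tsupport_weilConv_subset (hasCompactSupport_tri b₀)).trans ?_
  rintro x ⟨u, hu, v, hv, rfl⟩
  have hu' := tsupport_tri_subset b₀ hu
  have hv' := tsupport_ηc_subset hv
  simp only [mem_Icc] at hu' hv' ⊢
  constructor <;> linarith [hu'.1, hu'.2, hv'.1, hv'.2]

/-- `supp g₀` sits in the half window `[-(log 2)/2, (log 2)/2]` (`1/3 + 1/100 < 0.3465 < (log 2)/2`). -/
theorem tsupport_g₀_subset_half_window :
    tsupport g₀ ⊆ Icc (-(Real.log 2 / 2)) (Real.log 2 / 2) := by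
  refine tsupport_g₀_subset.trans (Icc_subset_Icc ?_ ?_) <;>
    · have := Real.log_two_gt_d9; norm_num [b₀] at this ⊢; linarith

/-- The transform factorises: `ĝ₀ = Λ̂_{1/3} · η̂`. [folklore] -/
theorem weilMellin_g₀ (s : ℂ) : weilMellin g₀ s = weilMellin (tri b₀) s * weilMellin ηc s :=
  weilMellin_weilConv_holds (continuous_tri b₀) (hasCompactSupport_tri b₀) continuous_ηc
    isWeilTest_ηc.2 s

/-- **On the line**: `‖ĝ₀(1/2 + it)‖ ≤ b² sinc²(bt/2)`. [folklore] -/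
theorem norm_weilMellin_g₀_line_le (t : ℝ) :
    ‖weilMellin g₀ (1 / 2 + t * I)‖ ≤ b₀ ^ 2 * Real.sinc (b₀ * t / 2) ^ 2 := by
  have h0 : 0 ≤ b₀ ^ 2 * Real.sinc (b₀ * t / 2) ^ 2 := by positivity
  rw [weilMellin_g₀, norm_mul, weilMellin_tri_line (by norm_num [b₀]), Complex.norm_real,
    Real.norm_eq_abs, abs_of_nonneg h0]
  have := norm_weilMellin_ηc_line_le t
  nlinarith

/-- **On the line, lower bound**: `‖ĝ₀(1/2 + it)‖ ≥ b² sinc²(bt/2) cos(|t|/100)` for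
`|t| ≤ 100π`. [folklore] -/
theorem le_norm_weilMellin_g₀_line {t : ℝ} (ht : |t| / 100 ≤ π) :
    b₀ ^ 2 * Real.sinc (b₀ * t / 2) ^ 2 * Real.cos (|t| / 100) ≤ ‖weilMellin g₀ (1 / 2 + t * I)‖ := by
  have h0 : 0 ≤ b₀ ^ 2 * Real.sinc (b₀ * t / 2) ^ 2 := by positivity
  rw [weilMellin_g₀, norm_mul, weilMellin_tri_line (by norm_num [b₀]), Complex.norm_real,
    Real.norm_eq_abs, abs_of_nonneg h0]
  refine mul_le_mul_of_nonneg_left ?_ h0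
  exact (cos_le_re_weilMellin_ηc_line ht).trans (Complex.re_le_norm _)

/-- **In the strip**: `‖ĝ₀(s)‖ ≤ (2e^{1/6} + 2) e^{1/200} / (Im s)²` for `0 ≤ Re s ≤ 1`, `Im s ≠ 0`.
[folklore] -/
theorem norm_weilMellin_g₀_le {s : ℂ} (hs0 : 0 ≤ s.re) (hs1 : s.re ≤ 1) (hsi : s.im ≠ 0) :
    ‖weilMellin g₀ s‖ ≤ (2 * Real.exp (b₀ / 2) + 2) * Real.exp (1 / 200) / s.im ^ 2 := by
  rw [weilMellin_g₀, norm_mul]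
  have h1 := norm_weilMellin_tri_le (b := b₀) (by norm_num [b₀]) hs0 hs1 hsi
  have h2 := norm_weilMellin_ηc_le hs0 hs1
  have hpos : 0 < s.im ^ 2 := by positivity
  calc ‖weilMellin (tri b₀) s‖ * ‖weilMellin ηc s‖
      ≤ (2 * Real.exp (b₀ / 2) + 2) / s.im ^ 2 * Real.exp (1 / 200) :=
        mul_le_mul h1 h2 (norm_nonneg _) (by positivity)
    _ = (2 * Real.exp (b₀ / 2) + 2) * Real.exp (1 / 200) / s.im ^ 2 := by ring

end TestFunction


/-! ## §D Numerical lemmas -/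

section Numerics

/-- `sinc` is antitone on `[0, π]` (secant slopes of the concave `sin` through `0`). [folklore] -/
theorem sinc_antitoneOn : AntitoneOn Real.sinc (Icc 0 π) := by
  intro x hx y hy hxy
  rcases eq_or_lt_of_le hx.1 with h0 | hx0
  · rw [← h0, Real.sinc_zero]; exact Real.sinc_le_one y
  have hy0 : 0 < y := lt_of_lt_of_le hx0 hxy
  have hconv : ConvexOn ℝ (Icc 0 π) (fun t => -Real.sin t) := strictConcaveOn_sin_Icc.concaveOn.neg
  have h := hconv.secant_mono (a := 0) (x := x) (y := y) ⟨le_rfl, Real.pi_pos.le⟩ hx hy hx0.ne' hy0.ne' hxy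
  simp only [Real.sin_zero, neg_zero, sub_zero] at h
  rw [Real.sinc_of_ne_zero hx0.ne', Real.sinc_of_ne_zero hy0.ne']
  rw [neg_div, neg_div, neg_le_neg_iff] at h
  exact h

/-- `sinc(11/6) ≥ 0.5265` (`sin(11/6) = cos(11/6 - π/2) ≥ 1 - (11/6 - π/2)²/2`). [folklore] -/
theorem sinc_eleven_sixths_ge : (0.5265 : ℝ) ≤ Real.sinc (11 / 6) := by
  rw [Real.sinc_of_ne_zero (by norm_num), ← Real.cos_sub_pi_div_two]
  have h1 := Real.one_sub_sq_div_two_le_cos (x := 11 / 6 - π / 2)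
  have hpi1 := Real.pi_gt_d6
  have hpi2 := Real.pi_lt_d6
  rw [le_div_iff₀ (by norm_num)]
  nlinarith

/-- For `|r| ≤ 11`: `sinc(|r|/6) ≥ 0.5265`. [folklore] -/
theorem sinc_ge_of_abs_le {r : ℝ} (hr : |r| ≤ 11) : (0.5265 : ℝ) ≤ Real.sinc (b₀ * r / 2) := by
  have heq : Real.sinc (b₀ * r / 2) = Real.sinc (|r| / 6) := by
    rcases le_or_gt 0 r with h | h
    · rw [abs_of_nonneg h, b₀]; ring_nf
    · rw [abs_of_neg h, b₀, ← Real.sinc_neg]; ring_nf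
  rw [heq]
  refine sinc_eleven_sixths_ge.trans ?_
  have hpi := Real.pi_gt_d6
  exact sinc_antitoneOn ⟨by positivity, by linarith⟩ ⟨by norm_num, by linarith⟩ (by linarith)

/-- For `|r| ≤ 11`: `cos(|r|/100) ≥ 0.99395`. [folklore] -/
theorem cos_ge_of_abs_le {r : ℝ} (hr : |r| ≤ 11) : (0.99395 : ℝ) ≤ Real.cos (|r| / 100) := by
  have h1 := Real.one_sub_sq_div_two_le_cos (x := |r| / 100)
  have h0 := abs_nonneg r
  nlinarith

/-- On the first bracket: `sin²(t/6) ≤ 0.5166` for `t ∈ [3606/2⁸, 3630/2⁸]`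
(`sin(t/6) = sin(π - t/6)`, `sin y ≤ y - y³/6 + y⁵/100`). [folklore] -/
theorem sin_sq_le_bracket₁ {t : ℝ} (ht : t ∈ Icc ((3606 : ℝ) / 256) (3630 / 256)) :
    Real.sin (b₀ * t / 2) ^ 2 ≤ 0.5166 := by
  have hpi1 := Real.pi_gt_d6
  have hpi2 := Real.pi_lt_d6
  set y : ℝ := π - b₀ * t / 2 with hy
  have hy0 : 0.778 ≤ y := by rw [hy, b₀]; linarith [ht.2]
  have hy1 : y ≤ 0.794 := by rw [hy, b₀]; linarith [ht.1]
  have hsin : Real.sin (b₀ * t / 2) = Real.sin y := by rw [hy, Real.sin_pi_sub]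
  rw [hsin]
  have hb := Real.sin_bound (x := y) (by rw [abs_le]; constructor <;> linarith)
  rw [abs_le] at hb
  have hyabs : |y| = y := abs_of_nonneg (by linarith)
  rw [hyabs] at hb
  have hy5 : y ^ 5 ≤ 0.794 ^ 5 := pow_le_pow_left₀ (by linarith) hy1 5
  have hy3 : (0.778 : ℝ) ^ 3 ≤ y ^ 3 := pow_le_pow_left₀ (by norm_num) hy0 3
  have hup : Real.sin y ≤ 0.7187 := by nlinarith [hb.2, hy5, hy3]
  have hlow : 0 ≤ Real.sin y := Real.sin_nonneg_of_nonneg_of_le_pi (by linarith) (by linarith)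
  nlinarith

/-- On the second bracket: `sin²(t/6) ≤ 0.1371` for `t ∈ [5370/2⁸, 5394/2⁸]`
(`sin(t/6) = -sin(t/6 - π)`, `sin y ≤ y`). [folklore] -/
theorem sin_sq_le_bracket₂ {t : ℝ} (ht : t ∈ Icc ((5370 : ℝ) / 256) (5394 / 256)) :
    Real.sin (b₀ * t / 2) ^ 2 ≤ 0.1371 := by
  have hpi1 := Real.pi_gt_d6
  have hpi2 := Real.pi_lt_d6
  set y : ℝ := b₀ * t / 2 - π with hy
  have hy0 : 0 ≤ y := by rw [hy, b₀]; linarith [ht.1]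
  have hy1 : y ≤ 0.3702 := by rw [hy, b₀]; linarith [ht.2]
  have hsin : Real.sin (b₀ * t / 2) ^ 2 = Real.sin y ^ 2 := by
    rw [hy, Real.sin_sub_pi, neg_sq]
  rw [hsin]
  have h1 : Real.sin y ≤ y := Real.sin_le hy0
  have h2 : 0 ≤ Real.sin y := Real.sin_nonneg_of_nonneg_of_le_pi hy0 (by linarith)
  nlinarith

/-- `e^{1/6} ≤ 6/5` and `e^{1/200} ≤ 200/199`. [folklore] -/
theorem exp_consts_le : Real.exp (b₀ / 2) ≤ 6 / 5 ∧ Real.exp (1 / 200) ≤ 200 / 199 := by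
  constructor
  · have := Real.exp_bound_div_one_sub_of_interval (x := b₀ / 2) (by norm_num [b₀]) (by norm_num [b₀])
    norm_num [b₀] at this ⊢
    exact this
  · have := Real.exp_bound_div_one_sub_of_interval (x := 1 / 200) (by norm_num) (by norm_num)
    norm_num at this ⊢
    exact this

/-- The strip constant `C = (2e^{1/6} + 2) e^{1/200} ≤ 4.4222`. [folklore] -/
theorem stripConst_le : (2 * Real.exp (b₀ / 2) + 2) * Real.exp (1 / 200) ≤ 4.4222 := by
  obtain ⟨h1, h2⟩ := exp_consts_le
  have h3 : 0 ≤ Real.exp (1 / 200) := (Real.exp_pos _).le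
  nlinarith

end Numerics

/-! ## §E Assembly: the zero side of `Q(g₀)` and the low forbidden zone -/

section Assembly

/-- The bound on the transform kernel `G(t) = (b² sinc²(bt/2))²` at a located ordinate. -/
def Sbound (ab : ℕ × ℕ) : ℝ :=
  if ab = (3606, 3630) then 0.5166 else if ab = (5370, 5394) then 0.1371 else 1

/-- The per-bracket bound `M_ab = (4 S_ab / (a/2⁸)²)²`. -/
def Mk (ab : ℕ × ℕ) : ℝ := (4 * Sbound ab / (((ab.1 : ℝ) / 256) ^ 2)) ^ 2

theorem bracketList10_subset : ∀ ab ∈ bracketList10, ab ∈ bracketList := by decide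

theorem bracketList10_nodup : bracketList10.Nodup := by decide

/-- `G(pick ab) ≤ M_ab` on the first ten brackets. [folklore] -/
theorem kernel_pick_le {ab : ℕ × ℕ} (hab : ab ∈ bracketList10) :
    (b₀ ^ 2 * Real.sinc (b₀ * pick ab / 2) ^ 2) ^ 2 ≤ Mk ab := by
  have hab' := bracketList10_subset ab hab
  obtain ⟨⟨hlo, hhi⟩, -⟩ := pick_spec hab'
  have ha : (3606 : ℝ) ≤ ab.1 := by exact_mod_cast (bracketList_bounds ab hab').1
  have hpos : 0 < pick ab := lt_of_lt_of_le (by positivity) hlo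
  have hS : Real.sin (b₀ * pick ab / 2) ^ 2 ≤ Sbound ab := by
    unfold Sbound
    split_ifs with h1 h2
    · subst h1; exact sin_sq_le_bracket₁ ⟨hlo, hhi⟩
    · subst h2; exact sin_sq_le_bracket₂ ⟨hlo, hhi⟩
    · rw [sq_le_one_iff_abs_le_one]; exact Real.abs_sin_le_one _
  have hS0 : 0 ≤ Sbound ab := le_trans (sq_nonneg _) hS
  rw [sq_mul_sinc_sq_eq hpos.ne', Mk]
  have hden : ((ab.1 : ℝ) / 256) ^ 2 ≤ pick ab ^ 2 := pow_le_pow_left₀ (by positivity) hlo 2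
  have hdenpos : 0 < ((ab.1 : ℝ) / 256) ^ 2 := by positivity
  have hkey : 4 * Real.sin (b₀ * pick ab / 2) ^ 2 / pick ab ^ 2 ≤ 4 * Sbound ab / ((ab.1 : ℝ) / 256) ^ 2 :=
    calc 4 * Real.sin (b₀ * pick ab / 2) ^ 2 / pick ab ^ 2 ≤ 4 * Sbound ab / pick ab ^ 2 :=
          div_le_div_of_nonneg_right (by linarith) (by positivity)
      _ ≤ 4 * Sbound ab / ((ab.1 : ℝ) / 256) ^ 2 :=
          div_le_div_of_nonneg_left (by positivity) hdenpos hden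
  exact pow_le_pow_left₀ (by positivity) hkey 2

/-- The finset of the ten located low ordinates. -/
def Z10 : Finset ℝ := bracketList10.toFinset.image pick

theorem pick_injOn : Set.InjOn pick (bracketList10.toFinset : Set (ℕ × ℕ)) := by
  intro x hx y hy hxy
  exact List.inj_on_of_nodup_map pick_nodup (bracketList10_subset x (by simpa using hx))
    (bracketList10_subset y (by simpa using hy)) hxy

theorem pos_of_mem_Z10 {t : ℝ} (ht : t ∈ Z10) : 0 < t := by
  simp only [Z10, Finset.mem_image, List.mem_toFinset] at ht
  obtain ⟨ab, hab, rfl⟩ := ht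
  have hab' := bracketList10_subset ab hab
  have ha : (3606 : ℝ) ≤ ab.1 := by exact_mod_cast (bracketList_bounds ab hab').1
  exact lt_of_lt_of_le (by positivity) (pick_spec hab').1.1

/-- **The low part of the zero side**, in closed form:
`Σ_{|Im ρ| ≤ T*} U_{g₀}(ρ) ≤ 2 Σ_{k ≤ 10} M_k`. [folklore] -/
theorem sum_lowZeros_le : ∑ ρ ∈ lowZeros, zeroTerm g₀ ρ ≤ 2 * ∑ ab ∈ bracketList10.toFinset, Mk ab := by
  classical
  set G : ℝ → ℝ := fun t => (b₀ ^ 2 * Real.sinc (b₀ * t / 2) ^ 2) ^ 2 with hG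
  have hGeven : ∀ t, G (-t) = G t := by
    intro t; simp only [hG]
    rw [show b₀ * -t / 2 = -(b₀ * t / 2) by ring, Real.sinc_neg]
  have hG0 : ∀ t, 0 ≤ G t := fun t => by positivity
  -- (1) termwise: `U(ρ) ≤ G(Im ρ)` on the low zeros
  have h1 : ∀ ρ ∈ lowZeros, zeroTerm g₀ ρ ≤ G ((ρ : ℂ).im) := by
    intro ρ hρ
    obtain ⟨hre, hord, -⟩ := low_zero ρ.2 (mem_lowZeros.1 hρ)
    have hρeq : (ρ : ℂ) = 1 / 2 + ((ρ : ℂ).im : ℂ) * I := by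
      apply Complex.ext <;> simp [hre]
    have hρ' : 1 - conj (ρ : ℂ) = (ρ : ℂ) := by
      apply Complex.ext
      · simp [hre]; norm_num
      · simp
    unfold zeroTerm
    rw [hρ', hord]
    have hn := norm_weilMellin_g₀_line_le ((ρ : ℂ).im)
    rw [← hρeq] at hn
    have h0 := norm_nonneg (weilMellin g₀ ρ)
    simp only [hG, Int.cast_one, one_mul]
    nlinarith
  -- (2) the ordinates of the low zeros inject into `Z10 ∪ -Z10`
  have hinj : Set.InjOn (fun ρ : riemannZetaNontrivialZeros => (ρ : ℂ).im) (lowZeros : Set _) := by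
    intro ρ hρ ρ' hρ' h
    obtain ⟨hre, -, -⟩ := low_zero ρ.2 (mem_lowZeros.1 hρ)
    obtain ⟨hre', -, -⟩ := low_zero ρ'.2 (mem_lowZeros.1 hρ')
    apply Subtype.ext
    apply Complex.ext
    · simp only at h; rw [hre, hre']
    · exact h
  have hsub : lowZeros.image (fun ρ : riemannZetaNontrivialZeros => (ρ : ℂ).im) ⊆ Z10 ∪ Z10.image Neg.neg := by
    intro t ht
    rw [Finset.mem_image] at ht
    obtain ⟨ρ, hρ, rfl⟩ := ht
    obtain ⟨-, -, ab, hab, habs⟩ := low_zero ρ.2 (mem_lowZeros.1 hρ)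
    have hmem : pick ab ∈ Z10 := Finset.mem_image.2 ⟨ab, by simpa using hab, rfl⟩
    rw [Finset.mem_union]
    rcases le_or_gt 0 ((ρ : ℂ).im) with h | h
    · left; rw [abs_of_nonneg h] at habs; rw [habs]; exact hmem
    · right; rw [abs_of_neg h] at habs
      rw [Finset.mem_image]
      exact ⟨pick ab, hmem, by simp [← habs]⟩
  have hdisj : Disjoint Z10 (Z10.image Neg.neg) := by
    rw [Finset.disjoint_left]
    intro t ht ht'
    have h1 := pos_of_mem_Z10 ht
    rw [Finset.mem_image] at ht'
    obtain ⟨u, hu, rfl⟩ := ht'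
    have h2 := pos_of_mem_Z10 hu
    simp at h1
    linarith
  calc ∑ ρ ∈ lowZeros, zeroTerm g₀ ρ ≤ ∑ ρ ∈ lowZeros, G ((ρ : ℂ).im) := Finset.sum_le_sum h1
    _ = ∑ t ∈ lowZeros.image (fun ρ : riemannZetaNontrivialZeros => (ρ : ℂ).im), G t :=
        (Finset.sum_image hinj).symm
    _ ≤ ∑ t ∈ Z10 ∪ Z10.image Neg.neg, G t :=
        Finset.sum_le_sum_of_subset_of_nonneg hsub fun t _ _ => hG0 t
    _ = ∑ t ∈ Z10, G t + ∑ t ∈ Z10.image Neg.neg, G t := Finset.sum_union hdisj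
    _ = 2 * ∑ t ∈ Z10, G t := by
        rw [Finset.sum_image fun x _ y _ h => neg_injective h]
        simp only [hGeven]
        ring
    _ = 2 * ∑ ab ∈ bracketList10.toFinset, G (pick ab) := by rw [Z10, Finset.sum_image pick_injOn]
    _ ≤ 2 * ∑ ab ∈ bracketList10.toFinset, Mk ab := by
        gcongr with ab hab
        exact kernel_pick_le (by simpa using hab)

/-- The numerical value of the low bound: `2 Σ M_k ≤ 4.25·10⁻⁴`. [folklore] -/
theorem two_mul_sum_Mk_le : 2 * ∑ ab ∈ bracketList10.toFinset, Mk ab ≤ 0.000425 := by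
  rw [List.sum_toFinset _ bracketList10_nodup]
  simp only [bracketList10, List.map_cons, List.map_nil, List.sum_cons, List.sum_nil, Mk, Sbound]
  norm_num

/-- **The high part of the zero side**: for `|Im ρ| > T*`,
`U_{g₀}(ρ) ≤ C² κ · m(ρ)/|ρ|²`, `κ = (1 + T*⁻²)/T*²`. [folklore] -/
theorem zeroTerm_high_le {ρ : ℂ} (hρ : ρ ∈ riemannZetaNontrivialZeros) (hT : Tstar < |ρ.im|) :
    zeroTerm g₀ ρ ≤ 4.4222 ^ 2 * ((1 + 1 / Tstar ^ 2) / Tstar ^ 2) *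
      ((riemannZetaZeroOrder ρ : ℝ) / ‖ρ‖ ^ 2) := by
  have hre0 := ZetaZeros.riemannZetaNontrivialZeros.re_pos hρ
  have hre1 := ZetaZeros.riemannZetaNontrivialZeros.re_lt_one hρ
  have him : ρ.im ≠ 0 := ZetaZeros.riemannZetaNontrivialZeros.im_ne_zero hρ
  have hm : (1 : ℝ) ≤ riemannZetaZeroOrder ρ := by
    exact_mod_cast ZetaZeros.riemannZetaNontrivialZeros.one_le_order hρ
  have hT0 : 0 < Tstar := by norm_num [Tstar]
  -- the two transform values
  have hC := stripConst_le
  have hCpos : 0 ≤ (2 * Real.exp (b₀ / 2) + 2) * Real.exp (1 / 200) := by positivity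
  have hA : ‖weilMellin g₀ ρ‖ ≤ 4.4222 / ρ.im ^ 2 :=
    (norm_weilMellin_g₀_le hre0.le hre1.le him).trans
      (div_le_div_of_nonneg_right hC (by positivity))
  have hB : ‖weilMellin g₀ (1 - conj ρ)‖ ≤ 4.4222 / ρ.im ^ 2 := by
    have h1 : (1 - conj ρ).re = 1 - ρ.re := by simp
    have h2 : (1 - conj ρ).im = ρ.im := by simp
    have := norm_weilMellin_g₀_le (s := 1 - conj ρ) (by rw [h1]; linarith) (by rw [h1]; linarith)
      (by rw [h2]; exact him)
    rw [h2] at this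
    exact this.trans (div_le_div_of_nonneg_right hC (by positivity))
  -- `1/γ⁴ ≤ κ/|ρ|²`
  have hγ2 : Tstar ^ 2 < ρ.im ^ 2 := by
    have := sq_lt_sq' (by linarith [abs_nonneg ρ.im]) hT
    rwa [sq_abs] at this
  have hnorm : ‖ρ‖ ^ 2 ≤ 1 + ρ.im ^ 2 := by
    rw [Complex.sq_norm, Complex.normSq_apply]
    nlinarith [hre0, hre1]
  have hnormpos : 0 < ‖ρ‖ ^ 2 := by
    have : 0 < ‖ρ‖ := norm_pos_iff.2 (fun h => him (by rw [h]; simp))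
    positivity
  have hkey : 1 / (ρ.im ^ 2 * ρ.im ^ 2) ≤ (1 + 1 / Tstar ^ 2) / Tstar ^ 2 * (1 / ‖ρ‖ ^ 2) := by
    rw [div_mul_div_comm, mul_one, div_le_div_iff₀ (by positivity) (by positivity)]
    -- `‖ρ‖² T*² ≤ (1 + 1/T*²) γ⁴`
    have h1 : ‖ρ‖ ^ 2 ≤ ρ.im ^ 2 * (1 + 1 / Tstar ^ 2) := by
      have : 1 ≤ ρ.im ^ 2 / Tstar ^ 2 := by rw [le_div_iff₀ (by positivity)]; linarith
      calc ‖ρ‖ ^ 2 ≤ 1 + ρ.im ^ 2 := hnorm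
        _ ≤ ρ.im ^ 2 / Tstar ^ 2 + ρ.im ^ 2 := by linarith
        _ = ρ.im ^ 2 * (1 + 1 / Tstar ^ 2) := by ring
    have h2 : Tstar ^ 2 ≤ ρ.im ^ 2 := hγ2.le
    calc 1 * (Tstar ^ 2 * ‖ρ‖ ^ 2) = Tstar ^ 2 * ‖ρ‖ ^ 2 := one_mul _
      _ ≤ ρ.im ^ 2 * (ρ.im ^ 2 * (1 + 1 / Tstar ^ 2)) :=
          mul_le_mul h2 h1 (by positivity) (by positivity)
      _ = (1 + 1 / Tstar ^ 2) * (ρ.im ^ 2 * ρ.im ^ 2) := by ring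
  unfold zeroTerm
  have hm0 : (0 : ℝ) ≤ riemannZetaZeroOrder ρ := by linarith
  calc (riemannZetaZeroOrder ρ : ℝ) * ‖weilMellin g₀ ρ‖ * ‖weilMellin g₀ (1 - conj ρ)‖
      ≤ (riemannZetaZeroOrder ρ : ℝ) * (4.4222 / ρ.im ^ 2) * (4.4222 / ρ.im ^ 2) := by
        gcongr
    _ = 4.4222 ^ 2 * (riemannZetaZeroOrder ρ : ℝ) * (1 / (ρ.im ^ 2 * ρ.im ^ 2)) := by
        field_simp
    _ ≤ 4.4222 ^ 2 * (riemannZetaZeroOrder ρ : ℝ) * ((1 + 1 / Tstar ^ 2) / Tstar ^ 2 * (1 / ‖ρ‖ ^ 2)) :=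
        mul_le_mul_of_nonneg_left hkey (by positivity)
    _ = 4.4222 ^ 2 * ((1 + 1 / Tstar ^ 2) / Tstar ^ 2) * ((riemannZetaZeroOrder ρ : ℝ) / ‖ρ‖ ^ 2) := by
        ring

/-- Ford's bound transported to the subtype used here. -/
theorem tsum_order_div_norm_sq_le :
    ∑' ρ : riemannZetaNontrivialZeros, (riemannZetaZeroOrder (ρ : ℂ) : ℝ) / ‖(ρ : ℂ)‖ ^ 2 ≤ 0.0463 :=
  Literature.NumberTheory.LFunctions.tsum_zeroOrder_div_norm_sq_le

theorem summable_order_div_norm_sq' :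
    Summable fun ρ : riemannZetaNontrivialZeros => (riemannZetaZeroOrder (ρ : ℂ) : ℝ) / ‖(ρ : ℂ)‖ ^ 2 :=
  FordL33.summable_order_div_norm_sq

/-- **The high part of the zero side**: `Σ_{|Im ρ| > T*} U_{g₀}(ρ) ≤ C²κ · 0.0463`. [folklore] -/
theorem tsum_highZeros_le :
    ∑' ρ : {ρ : riemannZetaNontrivialZeros // ρ ∉ lowZeros}, zeroTerm g₀ ρ ≤
      4.4222 ^ 2 * ((1 + 1 / Tstar ^ 2) / Tstar ^ 2) * 0.0463 := by
  set K : ℝ := 4.4222 ^ 2 * ((1 + 1 / Tstar ^ 2) / Tstar ^ 2) with hK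
  have hK0 : 0 ≤ K := by rw [hK]; unfold Tstar; positivity
  have hS : Summable fun ρ : {ρ : riemannZetaNontrivialZeros // ρ ∉ lowZeros} => zeroTerm g₀ ρ :=
    (summable_zeroTerm isWeilTest_g₀).subtype _
  have hS2 : Summable fun ρ : {ρ : riemannZetaNontrivialZeros // ρ ∉ lowZeros} =>
      K * ((riemannZetaZeroOrder ((ρ : riemannZetaNontrivialZeros) : ℂ) : ℝ) /
        ‖((ρ : riemannZetaNontrivialZeros) : ℂ)‖ ^ 2) :=
    (summable_order_div_norm_sq'.subtype _).mul_left K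
  have hle : ∀ ρ : {ρ : riemannZetaNontrivialZeros // ρ ∉ lowZeros},
      zeroTerm g₀ ρ ≤ K * ((riemannZetaZeroOrder ((ρ : riemannZetaNontrivialZeros) : ℂ) : ℝ) /
        ‖((ρ : riemannZetaNontrivialZeros) : ℂ)‖ ^ 2) := by
    intro ρ
    have hρ : Tstar < |((ρ : riemannZetaNontrivialZeros) : ℂ).im| := by
      have := ρ.2
      rw [mem_lowZeros, not_le] at this
      exact this
    exact zeroTerm_high_le ρ.1.2 hρ
  calc ∑' ρ : {ρ : riemannZetaNontrivialZeros // ρ ∉ lowZeros}, zeroTerm g₀ ρ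
      ≤ ∑' ρ : {ρ : riemannZetaNontrivialZeros // ρ ∉ lowZeros},
          K * ((riemannZetaZeroOrder ((ρ : riemannZetaNontrivialZeros) : ℂ) : ℝ) /
            ‖((ρ : riemannZetaNontrivialZeros) : ℂ)‖ ^ 2) := hS.tsum_le_tsum hle hS2
    _ = K * ∑' ρ : {ρ : riemannZetaNontrivialZeros // ρ ∉ lowZeros},
          ((riemannZetaZeroOrder ((ρ : riemannZetaNontrivialZeros) : ℂ) : ℝ) /
            ‖((ρ : riemannZetaNontrivialZeros) : ℂ)‖ ^ 2) := tsum_mul_left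
    _ ≤ K * 0.0463 := by
        refine mul_le_mul_of_nonneg_left ?_ hK0
        refine le_trans ?_ tsum_order_div_norm_sq_le
        refine Summable.tsum_subtype_le _ {ρ : riemannZetaNontrivialZeros | ρ ∉ lowZeros} ?_
          summable_order_div_norm_sq'
        intro ρ
        have : (0 : ℝ) ≤ riemannZetaZeroOrder (ρ : ℂ) := by
          exact_mod_cast riemannZetaZeroOrder_nonneg (ZetaZeros.riemannZetaNontrivialZeros.ne_one ρ.2)
        positivity

/-- **The zero side of `Q(g₀)` is small**: `Re Q(g₀) ≤ 7.9·10⁻⁴`. [folklore] -/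
theorem re_weilQuadratic_g₀_le : (weilQuadratic g₀).re ≤ 0.00079 := by
  have h1 := re_weilQuadratic_le_tsum_zeroTerm isWeilTest_g₀
  rw [tsum_zeroTerm_eq_add isWeilTest_g₀] at h1
  have h2 := sum_lowZeros_le
  have h3 := two_mul_sum_Mk_le
  have h4 := tsum_highZeros_le
  have h5 : 4.4222 ^ 2 * ((1 + 1 / Tstar ^ 2) / Tstar ^ 2) * 0.0463 ≤ (0.000365 : ℝ) := by
    norm_num [Tstar]
  linarith

/-- **Unit masses** (Bochner form of the window identity on the half window, cf.
`…/Theorems/WindowTraceArch/Negative/UnitMass.lean`): for a real family reproducing `W` on the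
Weil tests supported in `[-log 2, log 2]` and a test `g` supported in `[-(log 2)/2, (log 2)/2]`,
one atom at `γ_j` already costs `‖ĝ(1/2 + iγ_j)‖² ≤ Re Q(g)`. [folklore] -/
theorem norm_sq_le_re_weilQuadratic_of_witness {ι : Type*} {γ : ι → ℝ}
    (h : ∀ g : ℝ → ℂ, IsWeilTest g → tsupport g ⊆ Icc (-Real.log 2) (Real.log 2) →
      HasSum (fun i => weilMellin g (1 / 2 + (γ i : ℂ) * I)) (weilFunctional g))
    {g : ℝ → ℂ} (hg : IsWeilTest g) (hgs : tsupport g ⊆ Icc (-(Real.log 2 / 2)) (Real.log 2 / 2))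
    (j : ι) : ‖weilMellin g (1 / 2 + (γ j : ℂ) * I)‖ ^ 2 ≤ (weilQuadratic g).re := by
  have hk : IsWeilTest (weilConv g (weilReflect g)) := hg.weilConv hg.weilReflect
  have hks : tsupport (weilConv g (weilReflect g)) ⊆ Icc (-Real.log 2) (Real.log 2) := by
    have := tsupport_weilConv_weilReflect_subset (a := Real.log 2 / 2) hg.2 hgs
    convert this using 2 <;> ring
  have hsumC : HasSum (fun i => (((‖weilMellin g (1 / 2 + (γ i : ℂ) * I)‖ ^ 2 : ℝ) : ℂ)))
      (weilFunctional (weilConv g (weilReflect g))) := by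
    simpa only [weilMellin_weilConv_weilReflect_half hg] using h _ hk hks
  have hsumR : HasSum (fun i => ‖weilMellin g (1 / 2 + (γ i : ℂ) * I)‖ ^ 2)
      (weilFunctional (weilConv g (weilReflect g))).re := by
    simpa only [Complex.reCLM_apply, Complex.ofReal_re] using hsumC.mapL Complex.reCLM
  have := sum_le_hasSum {j} (fun i _ => by positivity) hsumR
  simpa [weilQuadratic] using this

/-- **An atom at `|r| < 11` is expensive**: `‖ĝ₀(1/2 + ir)‖² ≥ 9.36·10⁻⁴`. [folklore] -/
theorem lowZone_lower {r : ℝ} (hr : |r| < 11) : (0.000936 : ℝ) ≤ ‖weilMellin g₀ (1 / 2 + r * I)‖ ^ 2 := by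
  have hπ : |r| / 100 ≤ π := by linarith [Real.pi_gt_three, abs_nonneg r]
  have h1 := le_norm_weilMellin_g₀_line hπ
  have h2 := sinc_ge_of_abs_le hr.le
  have h3 := cos_ge_of_abs_le hr.le
  have hs2 : (0.5265 : ℝ) ^ 2 ≤ Real.sinc (b₀ * r / 2) ^ 2 := pow_le_pow_left₀ (by norm_num) h2 2
  have h4 : (0.0306 : ℝ) ≤ b₀ ^ 2 * Real.sinc (b₀ * r / 2) ^ 2 * Real.cos (|r| / 100) := by
    have hb : b₀ ^ 2 = 1 / 9 := by norm_num [b₀]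
    rw [hb]
    have h0 : 0 ≤ Real.sinc (b₀ * r / 2) ^ 2 := sq_nonneg _
    nlinarith
  have h5 : (0.0306 : ℝ) ≤ ‖weilMellin g₀ (1 / 2 + r * I)‖ := h4.trans h1
  nlinarith

/-- **LOW FORBIDDEN ZONE (certified).** Every real family `γ` reproducing the Weil functional on
the Weil tests supported in `[-log 2, log 2]` — i.e. every witness of the crux `WindowTraceArch`
— satisfies `|γ_i| ≥ 11` for all `i`: no unit atom of an archimedean crystallisation can sit in
`(-11, 11)` (the first zero of `ζ` is at `14.13…`). [folklore] -/
theorem eleven_le_abs_of_windowTraceArch_witness {ι : Type*} {γ : ι → ℝ}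
    (h : ∀ g : ℝ → ℂ, IsWeilTest g → tsupport g ⊆ Icc (-Real.log 2) (Real.log 2) →
      HasSum (fun i => weilMellin g (1 / 2 + (γ i : ℂ) * I)) (weilFunctional g))
    (i : ι) : 11 ≤ |γ i| := by
  by_contra hlt
  rw [not_le] at hlt
  have hup := norm_sq_le_re_weilQuadratic_of_witness h isWeilTest_g₀ tsupport_g₀_subset_half_window i
  have hlow := lowZone_lower hlt
  have hQ := re_weilQuadratic_g₀_le
  linarith

open Summit.RiemannHypothesis.RiemannHypothesis.Theses.SpectralTrace in
/-- The crux with its witness pinned away from the origin: `WindowTraceArch` holds iff it holds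
with a family avoiding `(-11, 11)` (so provers lose nothing by building families with
`|γ_i| ≥ 11`, and MUST do so). [folklore] -/
theorem windowTraceArch_iff_far :
    WindowTraceArch ↔ ∃ (ι : Type) (γ : ι → ℝ), (∀ i, 11 ≤ |γ i|) ∧
      ∀ g : ℝ → ℂ, IsWeilTest g → tsupport g ⊆ Icc (-Real.log 2) (Real.log 2) →
        HasSum (fun i => weilMellin g (1 / 2 + (γ i : ℂ) * I)) (weilFunctional g) := by
  constructor
  · rintro ⟨ι, γ, h⟩
    exact ⟨ι, γ, fun i => eleven_le_abs_of_windowTraceArch_witness h i, h⟩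
  · rintro ⟨ι, γ, -, h⟩
    exact ⟨ι, γ, h⟩

/-- **Refutation of the natural strengthening** "some archimedean window-trace family has a
low-lying point": no witness of `WindowTraceArch` has a point in `(-11, 11)`. [folklore] -/
theorem not_exists_windowTraceArch_witness_low :
    ¬ ∃ (ι : Type) (γ : ι → ℝ), (∀ g : ℝ → ℂ, IsWeilTest g →
        tsupport g ⊆ Icc (-Real.log 2) (Real.log 2) →
          HasSum (fun i => weilMellin g (1 / 2 + (γ i : ℂ) * I)) (weilFunctional g)) ∧
      ∃ i, |γ i| < 11 := by
  rintro ⟨ι, γ, h, i, hi⟩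
  exact not_le.2 hi (eleven_le_abs_of_windowTraceArch_witness h i)

end Assembly

end Summit.RiemannHypothesis.RiemannHypothesis.Cruxes.WindowTraceArch.LowZone

end
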